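import Literature.Probability.LatticeModels.PlaneRotatorStiffnessCutCovariance
import Literature.Probability.LatticeModels.PlaneRotatorTwistGaugeCovariance
import Literature.Probability.LatticeModels.PlaneRotatorTwistInequality
import Literature.Probability.LatticeModels.PlaneRotatorComponentCorrelationInequality
import Literature.Probability.LatticeModels.LayeredPlaneRotatorStarRegion
import HarnessLib

/-!
# The stack stiffness of the layered plane rotator on `(ℤ/Lℤ)³` (and the directional helicity modulus of
# `torusXY d L` at direction-dependent couplings): gauge class of slice twists, the cut–cut covariance in
# every dimension, and `βΥ^{3D}_L → 0` wherever ONE cube number is `< 1` — `T_Υ^{3D} ≤ T_χ^{3D}`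

Topic `Literature/Probability/LatticeModels`. Companion of `PlaneRotatorHelicityModulus.lean` (p536677: the twist
modulus `BondSystem.twistModulus = (−log Z)''(0)` of any finite bond system, `torusXYStiffness = βΥ_L` on `(ℤ/Lℤ)²`),
`PlaneRotatorTwistGaugeCovariance.lean` (p550612: gauge class and scaling of the modulus, any bond system),
`PlaneRotatorStiffnessCutCovariance.lean` (p547164: polarization `twistModulus_add_of_disjoint`; the cut–cut
covariance on `(ℤ/Lℤ)²` by duality), `PlaneRotatorComponentCorrelationInequality.lean` (p547672:
Bricmont–Fontaine–Landau Thm A2), `PlaneRotatorStiffnessTwoPointBound.lean` (p552758, the `d = 2` case of §4) and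
of the layered-rotator files `AnisotropicPlaneRotatorTorusBoxCriterion.lean` (p566301: `corr_eq_expectJ`, the torus
box criterion), `LayeredPlaneRotatorSusceptibilityDichotomy.lean` (p571826: cubes, `T_χ^{3D}` b.c.-independent),
`LayeredPlaneRotatorStarRegion.lean` (p582514), `LayeredPlaneRotatorSusceptibility.lean` (p563553). Everything
here is PROVED; two definitions (`axisProfile` — bookkeeping; `torusXYDirStiffness` — the object), no named fact.

## The object

For the nearest-neighbour plane rotator on the torus `(ℤ/Lℤ)^d` with DIRECTION-DEPENDENT couplings
`K = (K_m)_{m < d}` (`K_m = βJ_m` on every bond `(v, e_m)`; bond system `torusXY d L`, couplings `fun b => K b.2`,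
the grammar of `AnisotropicPlaneRotatorTorusBoxCriterion.lean`) and a twist direction `i`, the **reduced directional
helicity modulus**

  `βΥ_{L,i}(K) = (−log Z)''(0)/L^d`  for the uniform twist `θ_{v+eᵢ} − θ_v ↦ θ_{v+eᵢ} − θ_v + t` on every `eᵢ`-bond

(`torusXYDirStiffness L K i`; Fisher–Barber–Jasnow 1973 §II). For `d = 3`, `K = (βJ∥, βJ∥, βJ⊥)`
(`AnisotropicRotator.layeredCoupling`, Liu–Stanley's layered model `(J, J, εJ)`) and `i = 0` this is the in-plane
**stack stiffness** of `L` ferromagnetically coupled XY layers, for `i = 2` the interlayer (c-axis) stiffness; for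
`d = 2` and constant `K` it is `torusXYStiffness L K` (`torusXYDirStiffness_two`).

## Contents

* §1 Slice-constant twist profiles `axisProfile i p` (`p(vᵢ)` on `(v, eᵢ)`, `0` on other directions) and their
  **gauge class**: on the cycle `ℤ/L` every zero-sum function is a difference (`ψ(k+1) − ψ(k)`), so
  `axisProfile i p = ((∑_k p_k)/L)·(uniform eᵢ-twist) + ∇φ` (`exists_axisProfile_eq_smul_add_grad`); hence, for ANY
  real coupling function and every dimension, `Z_{J, axisProfile i p}(t) = Z_{J,u}((∑_k p_k/L)t)`
  (`twistPartitionFn_axisProfile`) and `Q_J(axisProfile i p) = ((∑_k p_k)/L)²·Q_J(u)` (`twistModulus_axisProfile`;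
  cuts: `Q(δ_j) = Q(u)/L²`, `Q(δ_j + δ_{j'}) = 4Q(u)/L²`) — by p550612's `twistModulus_eq_mul_sq_of_gauge`, where the
  `d = 2` file used the duality of `PlaneRotatorTwistDuality.lean`.
* §2 `torusXYDirStiffness`; `d = 2` consistency; `0 ≤ βΥ_{L,i}` (Ginibre, tree `twistModulus_nonneg`); all `eᵢ`-bond
  energies coincide (torus translations, tree `torusXY_expectJ_cosDiff_add_right`); the fluctuation formula
  `βΥ_{L,i} = K_i·E_i − ⟨𝒥_i²⟩/L^d` and the **f-sum bound `βΥ_{L,i}(K) ≤ K_i·⟨cos(θ_{x+eᵢ} − θ_x)⟩_K ≤ K_i`**.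
* §3 **The cut–cut covariance in every dimension**: for distinct hyperplane cuts `C_j = {(v,eᵢ) : vᵢ = j} ≠ C_{j'}`,
  `βΥ_{L,i}(K) = −(L²/L^d)·⟨𝒥_{C_j}𝒥_{C_{j'}}⟩_K`, `𝒥_{C_j} = K_i ∑_{b ∈ C_j} sin ∇θ_b`
  (`torusXYDirStiffness_eq_neg_covariance`; polarization p547164 + §1); linearity plumbing
  `BondSystem.expectJ_const_mul/_finset_sum` for any bond system.
* §4 **`|βΥ_{L,i}(K)| ≤ 4K_i²·L^d·B²`** whenever `⟨cos(θ_a − θ_c)⟩_{K,L} ≤ B` at `i`-coordinate (or torus) distance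
  `≥ ⌊L/2⌋ − 1` (`abs_torusXYDirStiffness_le_of_twoPoint_bound(_torusDist)`; component inequality p547672 over the
  `L^{d−1} × L^{d−1}` bond pairs of two cuts `⌊L/2⌋` apart); squeeze and the `o(L^{−d/2})` dichotomy.
* §5 (`namespace AnisotropicRotator`, `d = 3`, `K = (βJ∥, βJ∥, βJ⊥)`): f-sum bound against `corr`; under ONE cube
  `S_{(R,R,R)}(β; J∥, J⊥) ≤ 1`: `|βΥ_{L,i}| ≤ 4K_i²L³·S^{2⌊(⌊L/2⌋−1)/R⌋}` (`corr_layered_le_pow_cube`); hence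
  **`S_{(R,R,R)} < 1` for one `R ≥ 1` ⇒ `βΥ_{L,i} → 0` in every direction**
  (`tendsto_torusXYDirStiffness_layered_of_cube_lt_one`) — equivalently from `∑_z G^{3D,free,∞} < ∞`
  (`…_of_summable`) or from an eventually bounded periodic susceptibility `χ^{3D,per}_L(0)`
  (`…_of_torus_susceptibility_bounded`): **`T_Υ^{3D}(J∥, J⊥) ≤ T_χ^{3D}(J∥, J⊥)`, the structural half**, with the
  contrapositives (a surviving stack stiffness forces `χ^{3D} = ∞`, an unbounded torus susceptibility, and no
  terminating cube); explicit finite-`L` ceilings from explicit torus decay (Lieb's star with Amos' certificate; the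
  headline window `(1/2, 0.0298)`: `|βΥ_{L,i}| ≤ 4K_i²L³·0.99997^{2(⌊L/2⌋−1)}` for every `L ≥ 4`); and the regions of
  record: Lieb's STAR REGION `4x/√(x²+4) + 2y/√(y²+4) < 1` (coupling and temperature forms), the box-number window of
  `LayeredPlaneRotatorExplicitWindow.lean`, and the weak-interlayer window at EVERY in-plane coupling with a finite
  layer susceptibility (`∃ δ > 0: βJ∥ ≤ K₀ ∧ βJ⊥ ≤ δ ⇒ βΥ^{3D}_{L,i} → 0`; in particular for every
  `K₀ < log(1 + √2)`): `limsup_{J⊥ → 0} T_Υ^{3D}(J∥, J⊥) ≤ T_χ^{2D}(J∥)`.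

Reading (cell `pub/hubbard-tc`, G2 «2D → 3D ordering» in stiffness currency, classical layered comparison model):
the 3D stack stiffness vanishes in the thermodynamic limit throughout Lieb's star region and every explicit
weak-interlayer window of record; with `LayeredPlaneRotatorSusceptibility.lean` (`T_χ^{3D} → T_χ^{2D}` as `J⊥ → 0`)
the stiffness onset of the stack is bounded by the layer's susceptibility transition in the weak-interlayer limit.

## Design

* One bookkeeping definition (`axisProfile`) carries the uniform twist (`p ≡ 1`), single cuts (`p = δ_j`) and pairs
  of cuts (`p = δ_j + δ_{j'}`); the cut current is the tree's `twistCurrent` of the cut profile (no extra definition).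
* §1–§4 are stated for every dimension `d`, every twist direction `i` and (§1, §3) every real coupling function; the
  Borel structure of `Circle` is an instance ARGUMENT there (as in the `BondSystem.*` files). §5 uses the global
  instance fixed by the floor files (`AnisotropicRotator.corr`), at which the generic theorems specialise.
* The stiffness is normalised by `L^d` (sites = `eᵢ`-bonds), so that `d = 2` is literally `torusXYStiffness`.

## What this is not

A classical comparison-model file: no electron system, no number of the cell's tables, no `T_c`. Not here: the
infinite-volume stiffness of the stack (no `liminf` object is introduced; `PlaneRotatorStiffnessLiminf.lean` types the
two-dimensional one), positivity of the stack stiffness at low temperature (Fröhlich–Spencer / the infrared bound give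
long-range order, not `Υ > 0`, in the tree), the identity `βΥ^{3D}_{L,e₁}(K∥, 0) = βΥ^{2D}_L(K∥)` at zero interlayer
coupling (needs the product structure of the decoupled stack), and any comparison `Υ^{3D}` vs `Υ^{2D}` at `J⊥ > 0`.

## References

* M. E. Fisher, M. N. Barber, D. Jasnow, Phys. Rev. A 8 (1973) 1111, §II eqs. (2.3)–(2.5) (helicity modulus as the
  quadratic free-energy response to a twist; gauge equivalence of boundary twist and uniform gradient).
  [FisherBarberJasnow1973]
* A. W. Sandvik, AIP Conf. Proc. 1297 (2010) 135, arXiv:1101.3281, §(spin stiffness) pp. 26–27 (twisted boundary ≡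
  uniform twist; `ρ_s = (⟨H_x⟩ − β⟨I_x²⟩)/N`, `⟨I_x⟩ = 0`). [Sandvik2010]
* J. Bricmont, J.-R. Fontaine, L. J. Landau, Comm. Math. Phys. 56 (1977) 281, Appendix Thm A2. [BricmontFontaineLandau1977]
* E. H. Lieb, Comm. Math. Phys. 77 (1980) 127, Theorem 4 and p. 128 (boxes; the finite algorithm); B. Simon, ibid.
  111, Thm 1.3. [Lieb1980] [Simon1980CMP]
* L. L. Liu, H. E. Stanley, Phys. Rev. Lett. 29 (1972) 927 (layered couplings `(J, J, εJ)`). [LiuStanley1972]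
* D. E. Amos, Math. Comp. 28 (1974) 239, eq. (11) (Bessel ratio bound, via the tree). [Amos1974]
* M. Aizenman, B. Simon, Phys. Lett. 76A (1980) 281 (rotor–Ising comparison, via the tree). [AizenmanSimon1980RotorIsing]
* J. Ginibre, Comm. Math. Phys. 16 (1970) 310, Example 4 (plane rotators). [Ginibre1970]

Tree: `BondSystem.twistModulus(_eq/_le_energy/_nonneg/_add_of_disjoint/_eq_mul_sq_of_gauge)`,
`twistPartitionFn_eq_of_gauge`, `grad`, `twistCurrent`, `expectJ_twistCurrent_eq_zero`, `torusXYStiffness`,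
`torusTwistProfile`, `torusXY_expectJ_cosDiff_add_right`, `abs_expectJ_imChar_mul_imChar_le_cosDiff`,
`expectJ_reChar_diffChar_nonneg`, `AnisotropicRotator.corr(_eq_expectJ)`, `layeredCoupling(_nonneg)`,
`corr_layered_le_pow_cube`, `div_le_aIndex`, `aboxShellSum(_nonneg)`, `exists_cube_lt_one_of_summable_layered`,
`torus_susceptibility_bounded_iff_summable_layered`, `summable_layered_of_amos_star_lt_one/_temperature`,
`corr_layered_le_pow_amos_of_le`, `corr_layered_window_half`, `summable_layered_of_summable_layer`,
`summable_layered_of_lt_log_one_add_sqrt_two`, `summable_layered_of_nnBoxShellSum_lt_one`. Mathlib: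
`Equiv.piSplitAt`, `Fin.sum_univ_eq_sum_range`, `ZMod.val_add`, `ZMod.natAbs_valMinAbs_add_le`,
`tendsto_pow_const_mul_const_pow_of_abs_lt_one`, `squeeze_zero_norm'`.
-/

noncomputable section

open MeasureTheory Finset Filter
open scoped BigOperators Topology

namespace Literature.Probability.LatticeModels

open PlaneRotator Literature.Barriers.CriticalPhenomena Literature.Barriers.CriticalPhenomena.LongRangeIsing
open Literature.MathematicalPhysics.QuantumLattice

variable {d L : ℕ}

/-! ## §1 Slice-constant twist profiles along a lattice direction and their gauge class -/

section Profiles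

/-- The **slice-constant twist profile along `eᵢ`** with slice function `p : ℤ/L → ℝ`: on the bond
`(v, eᵢ) : v → v + eᵢ` of `torusXY d L` the twist is `p(vᵢ)`, on the bonds of the other directions it is `0`.
`p ≡ 1` is the uniform twist along `eᵢ` (one unit of phase gradient per lattice spacing, Fisher–Barber–Jasnow's
twisted ensemble); `p = δ_j` twists the single cut `C_j = {(v, eᵢ) : vᵢ = j}` (a twisted boundary condition).
[cite: FisherBarberJasnow1973, §II eqs. (2.3)–(2.5) (uniform twist / twisted boundary)] -/
def axisProfile (i : Fin d) (p : ZMod L → ℝ) (b : TorusSite d L × Fin d) : ℝ :=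
  if b.2 = i then p (b.1 i) else 0

/-- The profile is additive in the slice function. [cite: FisherBarberJasnow1973, §II eqs. (2.3)–(2.5)] -/
theorem axisProfile_add (i : Fin d) (p q : ZMod L → ℝ) :
    axisProfile i (p + q) = axisProfile i p + axisProfile i q := by
  funext b
  by_cases h : b.2 = i <;> simp [axisProfile, h]

/-- The profile is homogeneous in the slice function. [cite: FisherBarberJasnow1973, §II eqs. (2.3)–(2.5)] -/
theorem axisProfile_smul (i : Fin d) (c : ℝ) (p : ZMod L → ℝ) :
    axisProfile i (c • p) = c • axisProfile i p := by
  funext b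
  by_cases h : b.2 = i <;> simp [axisProfile, h]

/-- Slice functions with disjoint supports give profiles with disjoint supports. [cite: FisherBarberJasnow1973, §II eqs. (2.3)–(2.5)] -/
theorem axisProfile_mul_eq_zero (i : Fin d) {p q : ZMod L → ℝ} (hpq : ∀ k, p k * q k = 0)
    (b : TorusSite d L × Fin d) : axisProfile i p b * axisProfile i q b = 0 := by
  by_cases h : b.2 = i <;> simp [axisProfile, h, hpq]

/-- The single-cut profile `δ_j` along `eᵢ`: `1` on the bonds `(v, eᵢ)` with `vᵢ = j`, `0` elsewhere.
[cite: FisherBarberJasnow1973, §II eqs. (2.3)–(2.5) (twisted boundary)] -/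
theorem axisProfile_single_apply [DecidableEq (ZMod L)] (i : Fin d) (j : ZMod L) (b : TorusSite d L × Fin d) :
    axisProfile i (Pi.single j (1 : ℝ)) b = if b.2 = i ∧ b.1 i = j then 1 else 0 := by
  unfold axisProfile
  by_cases h : b.2 = i
  · by_cases h' : b.1 i = j
    · subst h'; simp [h]
    · simp [h, h']
  · simp [h]

/-- The single-cut profile is nonnegative. [cite: FisherBarberJasnow1973, §II eqs. (2.3)–(2.5)] -/
theorem axisProfile_single_nonneg [DecidableEq (ZMod L)] (i : Fin d) (j : ZMod L) (b : TorusSite d L × Fin d) :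
    0 ≤ axisProfile i (Pi.single j (1 : ℝ)) b := by
  rw [axisProfile_single_apply]; split_ifs <;> norm_num

/-- The uniform profile along `e₁` of `(ℤ/Lℤ)²` is the tree's `torusTwistProfile`. [cite: FisherBarberJasnow1973, §II eqs. (2.3)–(2.5) (uniform twist)] -/
theorem axisProfile_zero_one_eq_torusTwistProfile : axisProfile (0 : Fin 2) (1 : ZMod L → ℝ) = torusTwistProfile L := by
  funext b
  simp [axisProfile, torusTwistProfile]

variable [NeZero L]

/-- `|𝕋^d_L| = L^d`. [folklore] -/
private theorem card_torusSite_cast : (Fintype.card (TorusSite d L) : ℝ) = (L : ℝ) ^ d := by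
  rw [Fintype.card_fun, ZMod.card, Fintype.card_fin]; push_cast; ring

/-- **Slices of the torus**: `∑_{v ∈ 𝕋^d_L} f(vᵢ) = L^{d−1} ∑_{k ∈ ℤ/L} f(k)`. [folklore] -/
private theorem sum_apply_coord (i : Fin d) (f : ZMod L → ℝ) :
    ∑ v : TorusSite d L, f (v i) = (L : ℝ) ^ (d - 1) * ∑ k : ZMod L, f k := by
  classical
  rw [Fintype.sum_equiv (Equiv.piSplitAt i (fun _ : Fin d => ZMod L)) (fun v => f (v i))
      (fun q => f q.1) (fun v => rfl), Fintype.sum_prod_type]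
  simp only [Finset.sum_const, Finset.card_univ, nsmul_eq_mul]
  rw [← Finset.mul_sum]
  congr 1
  rw [Fintype.card_fun, ZMod.card, Fintype.card_subtype_compl, Fintype.card_fin, Fintype.card_unique]
  push_cast
  ring

/-- The uniform profile is `0/1`-valued: `∑_b u_b² = ∑_b u_b = |𝕋^d_L| = L^d` (one `eᵢ`-bond per site).
[cite: FisherBarberJasnow1973, §II eqs. (2.3)–(2.5) (uniform twist)] -/
theorem sum_axisProfile_one_sq (i : Fin d) :
    ∑ b : TorusSite d L × Fin d, axisProfile i (1 : ZMod L → ℝ) b ^ 2 = (L : ℝ) ^ d := by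
  rw [Fintype.sum_prod_type]
  have h : ∀ v : TorusSite d L, ∑ m : Fin d, axisProfile i (1 : ZMod L → ℝ) (v, m) ^ 2 = 1 := fun v => by
    rw [Finset.sum_eq_single i (fun m _ hm => by simp [axisProfile, hm]) (fun h => absurd (Finset.mem_univ i) h)]
    simp [axisProfile]
  simp only [h, Finset.sum_const, Finset.card_univ, nsmul_eq_mul, mul_one]
  exact card_torusSite_cast

/-- `∑_b (axisProfile i p)_b = L^{d−1} · ∑_k p(k)` (each slice `{vᵢ = k}` has `L^{d−1}` sites).
[cite: FisherBarberJasnow1973, §II eqs. (2.3)–(2.5)] -/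
theorem sum_axisProfile (i : Fin d) (p : ZMod L → ℝ) :
    ∑ b : TorusSite d L × Fin d, axisProfile i p b = (L : ℝ) ^ (d - 1) * ∑ k : ZMod L, p k := by
  rw [Fintype.sum_prod_type]
  have h : ∀ v : TorusSite d L, ∑ m : Fin d, axisProfile i p (v, m) = p (v i) := fun v => by
    rw [Finset.sum_eq_single i (fun m _ hm => by simp [axisProfile, hm]) (fun h => absurd (Finset.mem_univ i) h)]
    simp [axisProfile]
  simp only [h]
  exact sum_apply_coord i p

/-- **Discrete antiderivative on the cycle `ℤ/L`**: a function with zero sum is a difference,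
`∑_k q(k) = 0 ⇒ ∃ ψ, ψ(k+1) − ψ(k) = q(k)` for all `k` (`ψ(k) = ∑_{m < k} q(m)`). [folklore] -/
private theorem exists_sub_eq_of_sum_eq_zero {q : ZMod L → ℝ} (hq : ∑ k, q k = 0) :
    ∃ ψ : ZMod L → ℝ, ∀ k, ψ (k + 1) - ψ k = q k := by
  classical
  refine ⟨fun k => ∑ m ∈ Finset.range k.val, q (m : ZMod L), fun k => ?_⟩
  have hlt := ZMod.val_lt k
  by_cases h : k.val + 1 < L
  · have h1 : (k + 1).val = k.val + 1 := by
      have : (1 : ZMod L).val = 1 := by rw [ZMod.val_one_eq_one_mod]; exact Nat.mod_eq_of_lt (by omega)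
      rw [ZMod.val_add, this, Nat.mod_eq_of_lt h]
    simp only [h1, Finset.sum_range_succ, ZMod.natCast_zmod_val, add_sub_cancel_left]
  · have hL : k.val + 1 = L := by omega
    have hk0 : k + 1 = 0 := by
      have : ((k.val + 1 : ℕ) : ZMod L) = 0 := by rw [hL, ZMod.natCast_self]
      simpa [ZMod.natCast_zmod_val] using this
    have hfull : ∑ m ∈ Finset.range L, q (m : ZMod L) = ∑ k : ZMod L, q k := by
      rw [← Fin.sum_univ_eq_sum_range (fun m => q (m : ZMod L)) L]
      exact Fintype.sum_equiv ⟨fun m : Fin L => ((m : ℕ) : ZMod L), fun k => ⟨k.val, ZMod.val_lt k⟩,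
        fun m => Fin.ext (ZMod.val_natCast_of_lt m.isLt), fun k => ZMod.natCast_zmod_val k⟩ _ _ fun _ => rfl
    have hsplit : ∑ m ∈ Finset.range L, q (m : ZMod L) = (∑ m ∈ Finset.range k.val, q (m : ZMod L)) + q k := by
      rw [show Finset.range L = Finset.range (k.val + 1) by rw [hL], Finset.sum_range_succ, ZMod.natCast_zmod_val]
    simp only [hk0, ZMod.val_zero, Finset.sum_range_zero, zero_sub]
    linarith

omit [NeZero L] in
/-- A slice-constant profile whose slice function is a difference `ψ(k+1) − ψ(k)` is a PURE GAUGE: the bond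
gradient of `v ↦ ψ(vᵢ)`. [cite: FisherBarberJasnow1973, §II eqs. (2.3)–(2.5) (gauge equivalence of twists)] -/
theorem axisProfile_eq_grad (i : Fin d) {q ψ : ZMod L → ℝ} (hψ : ∀ k, ψ (k + 1) - ψ k = q k) :
    axisProfile i q = (torusXY d L).grad fun v => ψ (v i) := by
  funext b
  obtain ⟨v, m⟩ := b
  change (if m = i then q (v i) else 0) = ψ ((v + Pi.single m (1 : ZMod L) : TorusSite d L) i) - ψ (v i)
  rw [Pi.add_apply]
  by_cases h : m = i
  · subst h
    rw [if_pos rfl, Pi.single_eq_same, hψ]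
  · rw [if_neg h, Pi.single_eq_of_ne (Ne.symm h), add_zero, sub_self]

/-- **The gauge class of a slice twist.** Every slice-constant twist profile along `eᵢ` is the uniform twist
scaled by its MEAN plus a pure gauge: `axisProfile i p = ((∑_k p_k)/L)·axisProfile i 1 + ∇φ`. (A twist of the
boundary condition by `α` across one cut and the uniform phase gradient `α/L` are the same problem.)
[cite: Sandvik2010, §(spin stiffness) pp. 26–27 of arXiv:1101.3281 (twisted boundary condition ≡ uniform twist field); FisherBarberJasnow1973 §II eqs. (2.3)–(2.5)] -/
theorem exists_axisProfile_eq_smul_add_grad (i : Fin d) (p : ZMod L → ℝ) :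
    ∃ φ : TorusSite d L → ℝ,
      axisProfile i p = ((∑ k, p k) / L) • axisProfile i (1 : ZMod L → ℝ) + (torusXY d L).grad φ := by
  set c : ℝ := (∑ k, p k) / L with hc
  have hL : (L : ℝ) ≠ 0 := Nat.cast_ne_zero.2 (NeZero.ne L)
  have hq : ∑ k : ZMod L, (p k - c) = 0 := by
    rw [Finset.sum_sub_distrib, Finset.sum_const, Finset.card_univ, ZMod.card, nsmul_eq_mul, hc]
    field_simp
    ring
  obtain ⟨ψ, hψ⟩ := exists_sub_eq_of_sum_eq_zero (q := fun k => p k - c) hq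
  refine ⟨fun v => ψ (v i), ?_⟩
  rw [← axisProfile_eq_grad i hψ]
  funext b
  simp only [Pi.add_apply, Pi.smul_apply, smul_eq_mul, axisProfile]
  split_ifs <;> simp

variable [MeasurableSpace Circle] [BorelSpace Circle]

/-- **Gauge covariance of slice twists (exact, every finite volume, any real couplings)**: the twisted
partition function of `torusXY d L` depends on a slice-constant `eᵢ`-profile only through its total,
`Z_{J, axisProfile i p}(t) = Z_{J, uniform eᵢ-twist}((∑_k p_k/L)·t)` (tree `twistPartitionFn_eq_of_gauge`). The
every-dimension, direction-dependent-coupling twin of `twistPartitionFn_cutTwistProfile_eq` (proved there by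
duality for `(ℤ/Lℤ)²`). [cite: Sandvik2010, §(spin stiffness) pp. 26–27 of arXiv:1101.3281 (twisted boundary ≡ uniform twist field); FisherBarberJasnow1973 §II eqs. (2.3)–(2.5)] -/
theorem twistPartitionFn_axisProfile (J : TorusSite d L × Fin d → ℝ) (i : Fin d) (p : ZMod L → ℝ) (t : ℝ) :
    (torusXY d L).twistPartitionFn J (axisProfile i p) t =
      (torusXY d L).twistPartitionFn J (axisProfile i (1 : ZMod L → ℝ)) ((∑ k, p k) / L * t) := by
  obtain ⟨φ, hφ⟩ := exists_axisProfile_eq_smul_add_grad i p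
  exact (torusXY d L).twistPartitionFn_eq_of_gauge J (axisProfile i 1) hφ t

/-- **The twist modulus of a slice twist scales with the square of its total**:
`Q_J(axisProfile i p) = ((∑_k p_k)/L)²·Q_J(uniform eᵢ-twist)` for every finite torus `(ℤ/Lℤ)^d`, every real
coupling function `J` and every slice function `p` (tree `twistModulus_eq_mul_sq_of_gauge`).
[cite: FisherBarberJasnow1973, §II eqs. (2.4)–(2.5) (helicity modulus: quadratic response in the total twist)] -/
theorem twistModulus_axisProfile (J : TorusSite d L × Fin d → ℝ) (i : Fin d) (p : ZMod L → ℝ) :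
    (torusXY d L).twistModulus J (axisProfile i p) =
      ((∑ k, p k) / L) ^ 2 * (torusXY d L).twistModulus J (axisProfile i (1 : ZMod L → ℝ)) := by
  obtain ⟨φ, hφ⟩ := exists_axisProfile_eq_smul_add_grad i p
  exact (torusXY d L).twistModulus_eq_mul_sq_of_gauge J (axisProfile i 1) hφ

/-- Twisting ONE cut `C_j` by `t` has modulus `Q(uniform)/L²`. [cite: Sandvik2010, §(spin stiffness) pp. 26–27 of arXiv:1101.3281 (twisted boundary ≡ uniform twist)] -/
theorem twistModulus_axisProfile_single [DecidableEq (ZMod L)] (J : TorusSite d L × Fin d → ℝ) (i : Fin d)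
    (j : ZMod L) :
    (torusXY d L).twistModulus J (axisProfile i (Pi.single j (1 : ℝ))) =
      (torusXY d L).twistModulus J (axisProfile i (1 : ZMod L → ℝ)) / (L : ℝ) ^ 2 := by
  rw [twistModulus_axisProfile, Finset.sum_pi_single', if_pos (Finset.mem_univ j)]
  ring

/-- Twisting TWO cuts `C_j`, `C_{j'}` (possibly equal) by `t` each has modulus `4·Q(uniform)/L²`.
[cite: FisherBarberJasnow1973, §II eqs. (2.4)–(2.5) (quadratic response in the total twist)] -/
theorem twistModulus_axisProfile_single_add_single [DecidableEq (ZMod L)] (J : TorusSite d L × Fin d → ℝ)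
    (i : Fin d) (j j' : ZMod L) :
    (torusXY d L).twistModulus J (axisProfile i (Pi.single j (1 : ℝ) + Pi.single j' 1)) =
      4 * (torusXY d L).twistModulus J (axisProfile i (1 : ZMod L → ℝ)) / (L : ℝ) ^ 2 := by
  rw [twistModulus_axisProfile]
  simp only [Pi.add_apply, Finset.sum_add_distrib, Finset.sum_pi_single', Finset.mem_univ, if_true]
  ring

end Profiles

/-! ## §2 The directional helicity modulus of `torusXY d L` at direction-dependent couplings -/

section Stiffness

variable [NeZero L] [MeasurableSpace Circle] [BorelSpace Circle]

/-- The **reduced directional helicity modulus** `βΥ_{L,i}(K)` of the nearest-neighbour plane rotator on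
`(ℤ/Lℤ)^d` with direction-dependent couplings `K = (K_m)_m` (`K_m = βJ_m` on the bonds `(v, e_m)`): the twist
modulus `(−log Z)''(0)` for the uniform twist along `eᵢ`, per site,
`βΥ_{L,i}(K) = (K_i ∑_{eᵢ-bonds}⟨cos ∇θ_b⟩ − ⟨(K_i ∑_{eᵢ-bonds} sin ∇θ_b)²⟩)/L^d`.
For `d = 3`, `K = (βJ∥, βJ∥, βJ⊥)` (`AnisotropicRotator.layeredCoupling`) and `i = 0` this is the IN-PLANE STACK
STIFFNESS of the layered XY model (`L` coupled layers), for `i = 2` its interlayer (c-axis) stiffness; for `d = 2`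
and constant `K` it is the tree's `torusXYStiffness L K` (`torusXYDirStiffness_two`).
[cite: FisherBarberJasnow1973, §II eqs. (2.4)–(2.5) (helicity modulus); LiuStanley1972 p. 272 (layers (J, J, εJ))] -/
def torusXYDirStiffness (L : ℕ) [NeZero L] (K : Fin d → ℝ) (i : Fin d) : ℝ :=
  (torusXY d L).twistModulus (fun b => K b.2) (axisProfile i (1 : ZMod L → ℝ)) / (L : ℝ) ^ d

/-- **Consistency with the two-dimensional object**: on `(ℤ/Lℤ)²` at constant coupling `K`, the directional
modulus along `e₁` is the tree's `torusXYStiffness L K = βΥ_L(K)`. [cite: FisherBarberJasnow1973, §II eqs. (2.4)–(2.5) (helicity modulus)] -/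
theorem torusXYDirStiffness_two (K : ℝ) : torusXYDirStiffness L (fun _ : Fin 2 => K) 0 = torusXYStiffness L K := by
  rw [torusXYDirStiffness, torusXYStiffness, axisProfile_zero_one_eq_torusTwistProfile, card_torusSite_cast]

/-- **`0 ≤ βΥ_{L,i}(K)`** for ferromagnetic couplings `K ≥ 0` (Ginibre's twist inequality, tree
`twistModulus_nonneg`). [cite: FisherBarberJasnow1973, §II eqs. (2.4)–(2.5); Ginibre1970 §2 Examples 2 and 4] -/
theorem torusXYDirStiffness_nonneg {K : Fin d → ℝ} (hK : ∀ m, 0 ≤ K m) (i : Fin d) :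
    0 ≤ torusXYDirStiffness L K i :=
  div_nonneg ((torusXY d L).twistModulus_nonneg (fun b => hK b.2) _) (by positivity)

omit [NeZero L] [MeasurableSpace Circle] [BorelSpace Circle] in
/-- The bond `(v, eᵢ)` has character `θ̄_v θ_{v+eᵢ}`: `Re χ_{(v,i)} = cos(θ_v − θ_{v+eᵢ})`. [folklore] -/
private theorem reChar_bondChar_torusXY (v : TorusSite d L) (i : Fin d) :
    reChar ((torusXY d L).bondChar (v, i)) = cosDiff v (v + Pi.single i 1) :=
  funext fun θ => (cosDiff_eq_reChar v (v + Pi.single i 1) θ).symm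

/-- **All `eᵢ`-bond energies coincide** (torus translations, tree `torusXY_expectJ_cosDiff_add_right`):
`⟨cos(θ_{v+eᵢ} − θ_v)⟩_K = ⟨cos(θ_{x+eᵢ} − θ_x)⟩_K`. [cite: Ginibre1970, Example 4 (plane rotators)] -/
theorem torusXY_expectJ_bond_eq (K : Fin d → ℝ) (v x : TorusSite d L) (i : Fin d) :
    (torusXY d L).expectJ (fun b => K b.2) (reChar ((torusXY d L).bondChar (v, i))) =
      (torusXY d L).expectJ (fun b => K b.2) (cosDiff x (x + Pi.single i 1)) := by
  rw [reChar_bondChar_torusXY]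
  have h := torusXY_expectJ_cosDiff_add_right K x (x + Pi.single i 1) (v - x)
  rwa [show x + (v - x) = v by abel, show x + Pi.single i 1 + (v - x) = v + Pi.single i 1 by abel] at h

/-- The f-sum of the uniform `eᵢ`-twist: `∑_b K_b u_b² ⟨cos ∇θ_b⟩ = L^d · K_i · ⟨cos(θ_{x+eᵢ} − θ_x)⟩` (any `x`).
[cite: FisherBarberJasnow1973, §II eqs. (2.4)–(2.5)] -/
theorem torusXY_fsum_axisProfile_one (K : Fin d → ℝ) (i : Fin d) (x : TorusSite d L) :
    ∑ b : TorusSite d L × Fin d, K b.2 * axisProfile i (1 : ZMod L → ℝ) b ^ 2 *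
        (torusXY d L).expectJ (fun b => K b.2) (reChar ((torusXY d L).bondChar b)) =
      (L : ℝ) ^ d * (K i * (torusXY d L).expectJ (fun b => K b.2) (cosDiff x (x + Pi.single i 1))) := by
  rw [Fintype.sum_prod_type]
  have h : ∀ v : TorusSite d L, ∑ m : Fin d, K (v, m).2 * axisProfile i (1 : ZMod L → ℝ) (v, m) ^ 2 *
      (torusXY d L).expectJ (fun b => K b.2) (reChar ((torusXY d L).bondChar (v, m))) =
      K i * (torusXY d L).expectJ (fun b => K b.2) (cosDiff x (x + Pi.single i 1)) := fun v => by
    rw [Finset.sum_eq_single i (fun m _ hm => by simp [axisProfile, hm]) (fun h => absurd (Finset.mem_univ i) h)]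
    simp only [axisProfile, if_true, Pi.one_apply, one_pow, mul_one]
    rw [torusXY_expectJ_bond_eq K v x i]
  simp only [h, Finset.sum_const, Finset.card_univ, nsmul_eq_mul]
  rw [card_torusSite_cast]

/-- **The fluctuation formula**: `βΥ_{L,i}(K) = K_i·E_i(K) − ⟨𝒥_i²⟩/L^d` with `E_i = ⟨cos(θ_{x+eᵢ} − θ_x)⟩_K`
the `eᵢ`-bond energy and `𝒥_i = K_i ∑_{eᵢ-bonds} sin ∇θ_b` the total `eᵢ`-current (Ohta–Jasnow / Sandvik's
`ρ_s = (⟨H_x⟩ − β⟨I_x²⟩)/N`, one direction). [cite: Sandvik2010, §(spin stiffness) p. 27 of arXiv:1101.3281 (ρ_s = (⟨H_x⟩ − β⟨I_x²⟩)/N); Thijssen2007 eq. (15.97)] -/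
theorem torusXYDirStiffness_eq_energy_sub_fluctuation (K : Fin d → ℝ) (i : Fin d) (x : TorusSite d L) :
    torusXYDirStiffness L K i =
      K i * (torusXY d L).expectJ (fun b => K b.2) (cosDiff x (x + Pi.single i 1)) -
        (torusXY d L).expectJ (fun b => K b.2)
            (fun θ => (torusXY d L).twistCurrent (fun b => K b.2) (axisProfile i (1 : ZMod L → ℝ)) θ ^ 2) /
          (L : ℝ) ^ d := by
  have hL : (L : ℝ) ^ d ≠ 0 := pow_ne_zero _ (Nat.cast_ne_zero.2 (NeZero.ne L))
  rw [torusXYDirStiffness, (torusXY d L).twistModulus_eq, torusXY_fsum_axisProfile_one K i x, sub_div,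
    mul_div_cancel_left₀ _ hL]

/-- **The f-sum bound `βΥ_{L,i}(K) ≤ K_i·⟨cos(θ_{x+eᵢ} − θ_x)⟩_K`** (any site `x`): the directional helicity
modulus is at most the coupling times the bond energy IN THAT DIRECTION (tree `twistModulus_le_energy`; for the
layered model: in-plane stiffness `≤ βJ∥·E∥`, interlayer stiffness `≤ βJ⊥·E⊥`).
[cite: FisherBarberJasnow1973, §II eqs. (2.4)–(2.5) (helicity modulus); Sandvik2010 §(spin stiffness)] -/
theorem torusXYDirStiffness_le_energy (K : Fin d → ℝ) (i : Fin d) (x : TorusSite d L) :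
    torusXYDirStiffness L K i ≤ K i * (torusXY d L).expectJ (fun b => K b.2) (cosDiff x (x + Pi.single i 1)) := by
  have hL : (0 : ℝ) < (L : ℝ) ^ d := pow_pos (Nat.cast_pos.2 (Nat.pos_of_ne_zero (NeZero.ne L))) _
  rw [torusXYDirStiffness, div_le_iff₀ hL]
  refine ((torusXY d L).twistModulus_le_energy _ _).trans (le_of_eq ?_)
  rw [torusXY_fsum_axisProfile_one K i x]
  ring

/-- **`βΥ_{L,i}(K) ≤ K_i`** for `K ≥ 0` (the bare bound `Υ_i ≤ J_i`). [cite: FisherBarberJasnow1973, §II eqs. (2.4)–(2.5) (helicity modulus)] -/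
theorem torusXYDirStiffness_le_coupling {K : Fin d → ℝ} (hK : ∀ m, 0 ≤ K m) (i : Fin d) :
    torusXYDirStiffness L K i ≤ K i := by
  refine (torusXYDirStiffness_le_energy K i 0).trans ?_
  have h1 : (torusXY d L).expectJ (fun b => K b.2) (cosDiff (0 : TorusSite d L) (0 + Pi.single i 1)) ≤ 1 :=
    (torusXY d L).expectJ_le_one (continuous_cosDiff _ _) fun θ => (le_abs_self _).trans (abs_cosDiff_le_one _ _ θ)
  nlinarith [hK i]

/-- The window `0 ≤ βΥ_{L,i}(K) ≤ K_i` for `K ≥ 0`, uniformly in the volume. [cite: FisherBarberJasnow1973, §II eqs. (2.4)–(2.5); Ginibre1970 §2 Examples 2 and 4] -/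
theorem torusXYDirStiffness_mem_Icc {K : Fin d → ℝ} (hK : ∀ m, 0 ≤ K m) (i : Fin d) :
    torusXYDirStiffness L K i ∈ Set.Icc 0 (K i) :=
  ⟨torusXYDirStiffness_nonneg hK i, torusXYDirStiffness_le_coupling hK i⟩

end Stiffness


/-! ## §3 The directional modulus as a cut–cut current covariance (every dimension) -/

section Covariance

variable [NeZero L] [MeasurableSpace Circle] [BorelSpace Circle]

/-- `⟨c·f⟩_J = c·⟨f⟩_J` for any finite bond system. [cite: Ginibre1970, Example 4 (plane rotators) — plumbing] -/
theorem BondSystem.expectJ_const_mul {V ι : Type*} [Fintype V] [Fintype ι] (G : BondSystem V ι) (J : ι → ℝ)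
    (c : ℝ) (f : (V → Circle) → ℝ) : G.expectJ J (fun θ => c * f θ) = c * G.expectJ J f := by
  rw [G.expectJ_eq, G.expectJ_eq, ← mul_div_assoc, ← integral_const_mul]
  congr 1
  exact integral_congr_ae (ae_of_all _ fun θ => by ring)

/-- `⟨∑_{a ∈ S} f_a⟩_J = ∑_{a ∈ S} ⟨f_a⟩_J` for continuous observables on any finite bond system.
[cite: Ginibre1970, Example 4 (plane rotators) — plumbing] -/
theorem BondSystem.expectJ_finset_sum {V ι α : Type*} [Fintype V] [Fintype ι] (G : BondSystem V ι) (J : ι → ℝ)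
    (S : Finset α) {f : α → (V → Circle) → ℝ} (hf : ∀ a, Continuous (f a)) :
    G.expectJ J (fun θ => ∑ a ∈ S, f a θ) = ∑ a ∈ S, G.expectJ J (f a) := by
  simp only [G.expectJ_eq]
  rw [← Finset.sum_div]
  congr 1
  have hint : ∀ a ∈ S, Integrable (fun θ => f a θ * G.weightJ J θ) (torusHaar V) := fun a _ =>
    integrable_torusHaar_of_continuous ((hf a).mul (G.continuous_weightJ J))
  rw [← integral_finsetSum _ hint]
  exact integral_congr_ae (ae_of_all _ fun θ => by simp only [Finset.sum_mul])

omit [MeasurableSpace Circle] [BorelSpace Circle] in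
/-- **The current of a slice twist**: `𝒥_{K, axisProfile i p}(θ) = K_i · ∑_b (axisProfile i p)_b sin ∇θ_b` — only
`eᵢ`-bonds carry the profile, and they all have coupling `K_i`. [cite: FisherBarberJasnow1973, §II eqs. (2.4)–(2.5) (twist current)] -/
theorem twistCurrent_axisProfile (K : Fin d → ℝ) (i : Fin d) (p : ZMod L → ℝ) (θ : TorusSite d L → Circle) :
    (torusXY d L).twistCurrent (fun b => K b.2) (axisProfile i p) θ =
      K i * ∑ b : TorusSite d L × Fin d, axisProfile i p b * imChar ((torusXY d L).bondChar b) θ := by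
  unfold BondSystem.twistCurrent
  rw [Finset.mul_sum]
  refine Finset.sum_congr rfl fun b _ => ?_
  obtain ⟨v, m⟩ := b
  by_cases h : m = i
  · subst m
    simp only [axisProfile, if_true]
    ring
  · simp [axisProfile, h]

/-- **Polarization across two distinct cuts**: for `j ≠ j'`, the uniform `eᵢ`-twist modulus is MINUS `L²` times the
covariance of the two cut currents, `Q_J(uniform eᵢ) = −L²·⟨𝒥_{J,δ_j} 𝒥_{J,δ_{j'}}⟩_J`
(`Q(δ_j + δ_{j'}) = 4Q(u)/L²`, `Q(δ_j) = Q(δ_{j'}) = Q(u)/L²` by the gauge class, and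
`Q(δ_j + δ_{j'}) = Q(δ_j) + Q(δ_{j'}) − 2⟨𝒥_{δ_j}𝒥_{δ_{j'}}⟩` by `twistModulus_add_of_disjoint`). Any real couplings `J`,
every dimension. [cite: FisherBarberJasnow1973, §II eqs. (2.4)–(2.5) (second-order twist response); Sandvik2010 §(spin stiffness) pp. 26–27] -/
theorem twistModulus_axisProfile_one_eq_neg_covariance [DecidableEq (ZMod L)] (J : TorusSite d L × Fin d → ℝ)
    (i : Fin d) {j j' : ZMod L} (hjj' : j ≠ j') :
    (torusXY d L).twistModulus J (axisProfile i (1 : ZMod L → ℝ)) =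
      -((L : ℝ) ^ 2 * (torusXY d L).expectJ J (fun θ =>
        (torusXY d L).twistCurrent J (axisProfile i (Pi.single j (1 : ℝ))) θ *
          (torusXY d L).twistCurrent J (axisProfile i (Pi.single j' (1 : ℝ))) θ)) := by
  have hdis : ∀ b : TorusSite d L × Fin d,
      axisProfile i (Pi.single j (1 : ℝ)) b * axisProfile i (Pi.single j' (1 : ℝ)) b = 0 :=
    axisProfile_mul_eq_zero i fun k => by
      by_cases hk : k = j
      · subst hk; rw [Pi.single_eq_of_ne hjj', mul_zero]
      · rw [Pi.single_eq_of_ne hk, zero_mul]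
  have hpol := (torusXY d L).twistModulus_add_of_disjoint J _ _ hdis
  rw [← axisProfile_add, twistModulus_axisProfile_single_add_single, twistModulus_axisProfile_single,
    twistModulus_axisProfile_single] at hpol
  have hL : (L : ℝ) ≠ 0 := Nat.cast_ne_zero.2 (NeZero.ne L)
  have hL2 : (L : ℝ) ^ 2 ≠ 0 := pow_ne_zero 2 hL
  rw [show 4 * (torusXY d L).twistModulus J (axisProfile i (1 : ZMod L → ℝ)) / (L : ℝ) ^ 2 =
    4 * ((torusXY d L).twistModulus J (axisProfile i (1 : ZMod L → ℝ)) / (L : ℝ) ^ 2) by ring] at hpol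
  have key : (torusXY d L).twistModulus J (axisProfile i (1 : ZMod L → ℝ)) / (L : ℝ) ^ 2 =
      -(torusXY d L).expectJ J (fun θ =>
        (torusXY d L).twistCurrent J (axisProfile i (Pi.single j (1 : ℝ))) θ *
          (torusXY d L).twistCurrent J (axisProfile i (Pi.single j' (1 : ℝ))) θ) := by
    linarith
  rw [div_eq_iff hL2] at key
  linarith

/-- **The directional helicity modulus as a cut–cut covariance** (every dimension `d`, direction-dependent
couplings `K`): for two DISTINCT hyperplane cuts `C_j = {(v, eᵢ) : vᵢ = j}`, `C_{j'}`,
`βΥ_{L,i}(K) = −(L²/L^d)·⟨𝒥_{C_j} 𝒥_{C_{j'}}⟩_K`, `𝒥_{C_j} = K_i ∑_{b ∈ C_j} sin ∇θ_b` — the input that lets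
correlation inequalities bound the stiffness from above. For `d = 2` this is the tree's
`torusXYStiffness_eq_neg_sq_mul_cutCurrent_covariance` (proved there by duality).
[cite: Sandvik2010, §(spin stiffness) pp. 26–27 of arXiv:1101.3281; FisherBarberJasnow1973 §II eqs. (2.4)–(2.5)] -/
theorem torusXYDirStiffness_eq_neg_covariance [DecidableEq (ZMod L)] (K : Fin d → ℝ) (i : Fin d) {j j' : ZMod L}
    (hjj' : j ≠ j') :
    torusXYDirStiffness L K i =
      -((L : ℝ) ^ 2 / (L : ℝ) ^ d * (torusXY d L).expectJ (fun b => K b.2) (fun θ =>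
        (torusXY d L).twistCurrent (fun b => K b.2) (axisProfile i (Pi.single j (1 : ℝ))) θ *
          (torusXY d L).twistCurrent (fun b => K b.2) (axisProfile i (Pi.single j' (1 : ℝ))) θ)) := by
  rw [torusXYDirStiffness, twistModulus_axisProfile_one_eq_neg_covariance _ i hjj']
  ring

/-- The mean cut current vanishes: `⟨𝒥_{C_j}⟩ = 0` (inversion symmetry, tree `expectJ_twistCurrent_eq_zero`).
[cite: Sandvik2010, §(spin stiffness) p. 27 of arXiv:1101.3281 (⟨I_x⟩ = 0 by symmetry)] -/
theorem expectJ_twistCurrent_axisProfile_eq_zero (J : TorusSite d L × Fin d → ℝ) (i : Fin d) (p : ZMod L → ℝ) :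
    (torusXY d L).expectJ J ((torusXY d L).twistCurrent J (axisProfile i p)) = 0 :=
  (torusXY d L).expectJ_twistCurrent_eq_zero J _

end Covariance

/-! ## §4 The directional modulus is controlled by the two-point function at distance `~L/2` in direction `i` -/

section TwoPoint

variable [NeZero L]

omit [NeZero L] in
/-- Cyclic distances `|valMinAbs(±(m + δ))| ≥ m − 1` for `m = ⌊L/2⌋`, `|δ| ≤ 1`. [folklore] -/
private theorem natAbs_valMinAbs_ge_of_near_half (hL : 4 ≤ L) {a : ZMod L} {δ : ZMod L}
    (ha : a = ((L / 2 : ℕ) : ZMod L) + δ ∨ a = -(((L / 2 : ℕ) : ZMod L) + δ))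
    (hδ : (δ.valMinAbs).natAbs ≤ 1) : L / 2 - 1 ≤ (a.valMinAbs).natAbs := by
  have hm : ((((L / 2 : ℕ) : ZMod L)).valMinAbs).natAbs = L / 2 := by
    rw [ZMod.valMinAbs_natCast_of_le_half (le_refl _), Int.natAbs_natCast]
  have key : L / 2 ≤ ((((L / 2 : ℕ) : ZMod L) + δ).valMinAbs).natAbs + 1 := by
    have e : ((L / 2 : ℕ) : ZMod L) = (((L / 2 : ℕ) : ZMod L) + δ) + (-δ) := by ring
    have h := ZMod.natAbs_valMinAbs_add_le ((((L / 2 : ℕ) : ZMod L)) + δ) (-δ)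
    rw [← e, hm] at h
    have h2 := (h.trans (Int.natAbs_add_le _ _))
    rw [ZMod.natAbs_valMinAbs_neg] at h2
    omega
  rcases ha with h | h
  · rw [h]; omega
  · rw [h, ZMod.natAbs_valMinAbs_neg]; omega

/-- **Coordinate distance `≤` torus distance**: `|valMinAbs(aᵢ − cᵢ)| ≤ dist_∞(a, c)` on `(ℤ/Lℤ)^d`.
[cite: FriedliVelenik2017, §3.1 (periodic sup norm)] -/
theorem natAbs_valMinAbs_coord_sub_le_torusDist (a c : TorusSite d L) (i : Fin d) :
    ((a i - c i).valMinAbs).natAbs ≤ torusDist a c := by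
  rw [torusDist, torusNorm, ZMod.valMinAbs_natAbs_eq_min, show a i - c i = (a - c) i from rfl]
  exact Finset.le_sup (f := fun k => min ((a - c) k).val (L - ((a - c) k).val)) (Finset.mem_univ i)

variable [MeasurableSpace Circle] [BorelSpace Circle]

/-- **The directional helicity modulus is bounded by the square of the two-point function at distance `~L/2`
in its own direction.** Every dimension `d`, direction-dependent couplings `K ≥ 0`, `L ≥ 4`, `B ≥ 0`: if
`⟨cos(θ_a − θ_c)⟩_{K,L} ≤ B` for all sites `a, c` at `i`-coordinate distance `|valMinAbs(aᵢ − cᵢ)| ≥ ⌊L/2⌋ − 1`,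
then

  `|βΥ_{L,i}(K)| ≤ 4·K_i²·L^d·B²`.

Proof: `βΥ_{L,i} = −(L²/L^d)⟨𝒥_{C_0}𝒥_{C_m}⟩`, `m = ⌊L/2⌋` (§3); the covariance is `K_i²` times a double sum over the
`L^{d−1} × L^{d−1}` bond pairs of the two cuts of bond-current correlations, each bounded by
`2(G(a,c)G(a',c') + G(a,c')G(a',c)) ≤ 4B²` (Bricmont–Fontaine–Landau Thm A2, tree
`abs_expectJ_imChar_mul_imChar_le_cosDiff`; `0 ≤ G ≤ B` at the four coordinate distances `≥ m − 1`). The `d = 2`,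
constant-`K` case is the tree's `abs_torusXYStiffness_le_of_twoPoint_bound`.
[cite: BricmontFontaineLandau1977, Appendix Thm A2 (decoupling input); FisherBarberJasnow1973 §II (Υ as a current response)] -/
theorem abs_torusXYDirStiffness_le_of_twoPoint_bound (hL : 4 ≤ L) {K : Fin d → ℝ} (hK : ∀ m, 0 ≤ K m)
    (i : Fin d) {B : ℝ} (hB : 0 ≤ B)
    (hG : ∀ a c : TorusSite d L, L / 2 - 1 ≤ ((a i - c i).valMinAbs).natAbs →
      (torusXY d L).expectJ (fun b => K b.2) (cosDiff a c) ≤ B) :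
    |torusXYDirStiffness L K i| ≤ 4 * K i ^ 2 * (L : ℝ) ^ d * B ^ 2 := by
  classical
  set m : ℕ := L / 2 with hm
  -- the two cuts `0` and `m`
  have hj : (0 : ZMod L) ≠ ((m : ℕ) : ZMod L) := by
    intro h
    have h' : ((m : ℕ) : ZMod L) = 0 := h.symm
    rw [ZMod.natCast_eq_zero_iff] at h'
    have : m < L := by omega
    have : 0 < m := by omega
    exact absurd (Nat.le_of_dvd this h') (by omega)
  have hL0 : (L : ℝ) ≠ 0 := Nat.cast_ne_zero.2 (NeZero.ne L)
  have hLpos : (0 : ℝ) < L := Nat.cast_pos.2 (Nat.pos_of_ne_zero (NeZero.ne L))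
  rw [torusXYDirStiffness_eq_neg_covariance K i hj, abs_neg, abs_mul,
    abs_of_nonneg (by positivity : (0 : ℝ) ≤ (L : ℝ) ^ 2 / (L : ℝ) ^ d)]
  -- the Ginibre floor and the hypothesis as one `Icc` statement
  have hIcc : ∀ a c : TorusSite d L, m - 1 ≤ ((a i - c i).valMinAbs).natAbs →
      (torusXY d L).expectJ (fun b => K b.2) (cosDiff a c) ∈ Set.Icc 0 B := by
    intro a c hac
    refine ⟨?_, hG a c hac⟩
    have h := (torusXY d L).expectJ_reChar_diffChar_nonneg (J := fun b => K b.2) (fun b => hK b.2) a c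
    have e : (cosDiff a c : (TorusSite d L → Circle) → ℝ) = reChar (diffChar a c) :=
      funext fun θ => cosDiff_eq_reChar a c θ
    rw [e]; exact h
  -- the two cut profiles
  set s0 : TorusSite d L × Fin d → ℝ := axisProfile i (Pi.single (0 : ZMod L) (1 : ℝ)) with hs0
  set sm : TorusSite d L × Fin d → ℝ := axisProfile i (Pi.single ((m : ℕ) : ZMod L) (1 : ℝ)) with hsm
  have hs0nn : ∀ b, 0 ≤ s0 b := fun b => axisProfile_single_nonneg i 0 b
  have hsmnn : ∀ b, 0 ≤ sm b := fun b => axisProfile_single_nonneg i _ b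
  -- the covariance as `K_i²` times a double sum of bond-current correlations
  have hexp : (torusXY d L).expectJ (fun b => K b.2) (fun θ =>
        (torusXY d L).twistCurrent (fun b => K b.2) s0 θ * (torusXY d L).twistCurrent (fun b => K b.2) sm θ) =
      K i ^ 2 * ∑ b, ∑ b', s0 b * sm b' *
        (torusXY d L).expectJ (fun b => K b.2)
          (fun θ => imChar ((torusXY d L).bondChar b) θ * imChar ((torusXY d L).bondChar b') θ) := by
    have e : (fun θ => (torusXY d L).twistCurrent (fun b => K b.2) s0 θ *
        (torusXY d L).twistCurrent (fun b => K b.2) sm θ) = fun θ : TorusSite d L → Circle =>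
        K i ^ 2 * ∑ b, ∑ b', s0 b * sm b' *
          (imChar ((torusXY d L).bondChar b) θ * imChar ((torusXY d L).bondChar b') θ) := by
      funext θ
      rw [hs0, hsm, twistCurrent_axisProfile, twistCurrent_axisProfile, ← hs0, ← hsm, mul_mul_mul_comm, ← sq,
        Finset.sum_mul_sum]
      congr 1
      exact Finset.sum_congr rfl fun b _ => Finset.sum_congr rfl fun b' _ => by ring
    have hcont : ∀ b b' : TorusSite d L × Fin d, Continuous fun θ : TorusSite d L → Circle =>
        imChar ((torusXY d L).bondChar b) θ * imChar ((torusXY d L).bondChar b') θ := fun b b' =>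
      (continuous_imChar _).mul (continuous_imChar _)
    have hc2 : ∀ b b' : TorusSite d L × Fin d, Continuous fun θ : TorusSite d L → Circle =>
        s0 b * sm b' * (imChar ((torusXY d L).bondChar b) θ * imChar ((torusXY d L).bondChar b') θ) :=
      fun b b' => continuous_const.mul (hcont b b')
    have hc1 : ∀ b : TorusSite d L × Fin d, Continuous fun θ : TorusSite d L → Circle =>
        ∑ b', s0 b * sm b' * (imChar ((torusXY d L).bondChar b) θ * imChar ((torusXY d L).bondChar b') θ) :=
      fun b => continuous_finsetSum _ fun b' _ => hc2 b b'
    rw [e, (torusXY d L).expectJ_const_mul,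
      (torusXY d L).expectJ_finset_sum (fun b => K b.2) Finset.univ (f := fun b θ => ∑ b', s0 b * sm b' *
        (imChar ((torusXY d L).bondChar b) θ * imChar ((torusXY d L).bondChar b') θ)) hc1]
    congr 1
    refine Finset.sum_congr rfl fun b _ => ?_
    rw [(torusXY d L).expectJ_finset_sum (fun b => K b.2) Finset.univ (f := fun b' θ => s0 b * sm b' *
      (imChar ((torusXY d L).bondChar b) θ * imChar ((torusXY d L).bondChar b') θ)) (hc2 b)]
    refine Finset.sum_congr rfl fun b' _ => ?_
    rw [← (torusXY d L).expectJ_const_mul]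
  rw [hexp]
  -- termwise bound `s0·sm·|X| ≤ s0·sm·4B²`
  have hterm : ∀ b b' : TorusSite d L × Fin d,
      |s0 b * sm b' * (torusXY d L).expectJ (fun b => K b.2)
          (fun θ => imChar ((torusXY d L).bondChar b) θ * imChar ((torusXY d L).bondChar b') θ)| ≤
        s0 b * sm b' * (4 * B ^ 2) := by
    rintro ⟨v, m₁⟩ ⟨w, m₂⟩
    rw [hs0, hsm, axisProfile_single_apply, axisProfile_single_apply]
    by_cases hb : m₁ = i ∧ v i = 0
    · by_cases hb' : m₂ = i ∧ w i = ((m : ℕ) : ZMod L)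
      · obtain ⟨hi, hv⟩ := hb
        obtain ⟨hi', hw⟩ := hb'
        subst m₁; subst m₂
        rw [if_pos ⟨rfl, hv⟩, if_pos ⟨rfl, hw⟩]
        simp only [one_mul]
        -- the decoupling by the component correlation inequality
        have hdec := (torusXY d L).abs_expectJ_imChar_mul_imChar_le_cosDiff (J := fun b => K b.2)
          (fun b => hK b.2) v (v + Pi.single i 1) w (w + Pi.single i 1)
        have hbc : ∀ u : TorusSite d L, (torusXY d L).bondChar (u, i) = diffChar u (u + Pi.single i 1) :=
          fun u => rfl
        rw [hbc, hbc]
        refine hdec.trans ?_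
        -- the four two-point functions, all at coordinate distance `≥ m − 1`
        have hδ1 : ((1 : ZMod L).valMinAbs).natAbs ≤ 1 := by
          have h := ZMod.valMinAbs_natCast_of_le_half (n := L) (a := 1) (by omega)
          rw [Nat.cast_one] at h; rw [h]; norm_num
        have hδ0 : ((0 : ZMod L).valMinAbs).natAbs ≤ 1 := by rw [ZMod.valMinAbs_zero]; norm_num
        have e1 : (v + Pi.single i 1 : TorusSite d L) i = v i + 1 := by
          rw [Pi.add_apply, Pi.single_eq_same]
        have e1' : (w + Pi.single i 1 : TorusSite d L) i = w i + 1 := by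
          rw [Pi.add_apply, Pi.single_eq_same]
        have G1 := hIcc v w
          (natAbs_valMinAbs_ge_of_near_half hL (δ := 0) (Or.inr (by rw [hv, hw]; ring)) hδ0)
        have G2 := hIcc (v + Pi.single i 1) (w + Pi.single i 1)
          (natAbs_valMinAbs_ge_of_near_half hL (δ := 0) (Or.inr (by rw [e1, e1', hv, hw]; ring)) hδ0)
        have G3 := hIcc v (w + Pi.single i 1)
          (natAbs_valMinAbs_ge_of_near_half hL (δ := 1) (Or.inr (by rw [e1', hv, hw]; ring)) hδ1)
        have G4 := hIcc (v + Pi.single i 1) w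
          (natAbs_valMinAbs_ge_of_near_half hL (δ := -1) (Or.inr (by rw [e1, hv, hw]; ring))
            (by rw [ZMod.natAbs_valMinAbs_neg]; exact hδ1))
        obtain ⟨g1l, g1u⟩ := G1
        obtain ⟨g2l, g2u⟩ := G2
        obtain ⟨g3l, g3u⟩ := G3
        obtain ⟨g4l, g4u⟩ := G4
        have p1 := mul_le_mul g1u g2u g2l hB
        have p2 := mul_le_mul g3u g4u g4l hB
        nlinarith
      · rw [if_neg hb']; simp
    · rw [if_neg hb]; simp
  -- sum up: `∑_b s0 = ∑_b sm = L^{d-1}`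
  have hsum0 : ∑ b, s0 b = (L : ℝ) ^ (d - 1) := by
    rw [hs0, sum_axisProfile, Finset.sum_pi_single', if_pos (Finset.mem_univ _), mul_one]
  have hsumm : ∑ b, sm b = (L : ℝ) ^ (d - 1) := by
    rw [hsm, sum_axisProfile, Finset.sum_pi_single', if_pos (Finset.mem_univ _), mul_one]
  have hd : d - 1 + 1 = d := Nat.sub_add_cancel (Nat.one_le_of_lt (Fin.pos i))
  have hN : (L : ℝ) ^ (d - 1) = (L : ℝ) ^ d / L := by
    rw [eq_div_iff hL0, ← pow_succ, hd]
  calc (L : ℝ) ^ 2 / (L : ℝ) ^ d * |K i ^ 2 * ∑ b, ∑ b', s0 b * sm b' *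
          (torusXY d L).expectJ (fun b => K b.2)
            (fun θ => imChar ((torusXY d L).bondChar b) θ * imChar ((torusXY d L).bondChar b') θ)|
      ≤ (L : ℝ) ^ 2 / (L : ℝ) ^ d * (K i ^ 2 * ∑ b, ∑ b', s0 b * sm b' * (4 * B ^ 2)) := by
        refine mul_le_mul_of_nonneg_left ?_ (by positivity)
        rw [abs_mul, abs_of_nonneg (sq_nonneg (K i))]
        refine mul_le_mul_of_nonneg_left ?_ (sq_nonneg (K i))
        refine (Finset.abs_sum_le_sum_abs _ _).trans (Finset.sum_le_sum fun b _ => ?_)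
        exact (Finset.abs_sum_le_sum_abs _ _).trans (Finset.sum_le_sum fun b' _ => hterm b b')
    _ = 4 * K i ^ 2 * (L : ℝ) ^ d * B ^ 2 := by
        have h : ∑ b, ∑ b', s0 b * sm b' * (4 * B ^ 2) = (∑ b, s0 b) * (∑ b', sm b') * (4 * B ^ 2) := by
          rw [Finset.sum_mul_sum, Finset.sum_mul]
          refine Finset.sum_congr rfl fun b _ => ?_
          rw [Finset.sum_mul]
        rw [h, hsum0, hsumm, hN]
        field_simp

/-- **Torus-distance form** (the shape decay criteria deliver): for `L ≥ 4`, `K ≥ 0`, `B ≥ 0`, if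
`⟨cos(θ_a − θ_c)⟩_{K,L} ≤ B` for all `a, c` with `dist_∞(a, c) ≥ ⌊L/2⌋ − 1`, then `|βΥ_{L,i}(K)| ≤ 4K_i²L^d·B²` for
every twist direction `i`. [cite: BricmontFontaineLandau1977, Appendix Thm A2; FisherBarberJasnow1973 §II] -/
theorem abs_torusXYDirStiffness_le_of_twoPoint_bound_torusDist (hL : 4 ≤ L) {K : Fin d → ℝ} (hK : ∀ m, 0 ≤ K m)
    (i : Fin d) {B : ℝ} (hB : 0 ≤ B)
    (hG : ∀ a c : TorusSite d L, L / 2 - 1 ≤ torusDist a c →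
      (torusXY d L).expectJ (fun b => K b.2) (cosDiff a c) ≤ B) :
    |torusXYDirStiffness L K i| ≤ 4 * K i ^ 2 * (L : ℝ) ^ d * B ^ 2 :=
  abs_torusXYDirStiffness_le_of_twoPoint_bound hL hK i hB fun a c hac =>
    hG a c (hac.trans (natAbs_valMinAbs_coord_sub_le_torusDist a c i))

/-- With the floor: **`0 ≤ βΥ_{L,i}(K) ≤ 4K_i²L^d·B²`**. [cite: BricmontFontaineLandau1977, Appendix Thm A2; FisherBarberJasnow1973 §II] -/
theorem torusXYDirStiffness_mem_Icc_of_twoPoint_bound (hL : 4 ≤ L) {K : Fin d → ℝ} (hK : ∀ m, 0 ≤ K m)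
    (i : Fin d) {B : ℝ} (hB : 0 ≤ B)
    (hG : ∀ a c : TorusSite d L, L / 2 - 1 ≤ torusDist a c →
      (torusXY d L).expectJ (fun b => K b.2) (cosDiff a c) ≤ B) :
    torusXYDirStiffness L K i ∈ Set.Icc 0 (4 * K i ^ 2 * (L : ℝ) ^ d * B ^ 2) :=
  ⟨torusXYDirStiffness_nonneg hK i,
    (le_abs_self _).trans (abs_torusXYDirStiffness_le_of_twoPoint_bound_torusDist hL hK i hB hG)⟩

omit [NeZero L] in
/-- **Squeeze**: an eventual majorant `|βΥ_{L+1,i}(K)| ≤ f(L)` with `f → 0` gives `βΥ_{L+1,i}(K) → 0` (`K ≥ 0`).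
[cite: FisherBarberJasnow1973, §II (helicity modulus)] -/
theorem tendsto_torusXYDirStiffness_of_abs_le {K : Fin d → ℝ} (hK : ∀ m, 0 ≤ K m) (i : Fin d) {f : ℕ → ℝ}
    (hf : Tendsto f atTop (𝓝 0))
    (h : ∀ᶠ L : ℕ in atTop, |torusXYDirStiffness (L + 1) K i| ≤ f L) :
    Tendsto (fun L : ℕ => torusXYDirStiffness (L + 1) K i) atTop (𝓝 0) := by
  refine tendsto_of_tendsto_of_tendsto_of_le_of_le' tendsto_const_nhds hf ?_ ?_
  · exact Eventually.of_forall fun L => torusXYDirStiffness_nonneg hK i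
  · filter_upwards [h] with L hL
    exact (le_abs_self _).trans hL

omit [NeZero L] in
/-- **The `o(L^{−d/2})` dichotomy**: if along the tori `L + 1` the two-point function at torus distance
`≥ ⌊(L+1)/2⌋ − 1` is eventually bounded by `B_L ≥ 0` with `(L+1)^d·B_L² → 0`, then `βΥ_{L+1,i}(K) → 0` for every
twist direction `i`. [cite: FisherBarberJasnow1973, §II (helicity modulus); BricmontFontaineLandau1977 Appendix Thm A2] -/
theorem tendsto_torusXYDirStiffness_of_twoPoint_bound {K : Fin d → ℝ} (hK : ∀ m, 0 ≤ K m) (i : Fin d)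
    {B : ℕ → ℝ} (hB : ∀ L, 0 ≤ B L)
    (hG : ∀ᶠ L : ℕ in atTop, ∀ a c : TorusSite d (L + 1), (L + 1) / 2 - 1 ≤ torusDist a c →
      (torusXY d (L + 1)).expectJ (fun b => K b.2) (cosDiff a c) ≤ B L)
    (hlim : Tendsto (fun L : ℕ => ((L : ℝ) + 1) ^ d * B L ^ 2) atTop (𝓝 0)) :
    Tendsto (fun L : ℕ => torusXYDirStiffness (L + 1) K i) atTop (𝓝 0) := by
  have hmaj : Tendsto (fun L : ℕ => 4 * K i ^ 2 * (((L : ℝ) + 1) ^ d * B L ^ 2)) atTop (𝓝 0) := by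
    simpa using hlim.const_mul (4 * K i ^ 2)
  refine tendsto_torusXYDirStiffness_of_abs_le hK i hmaj ?_
  filter_upwards [hG, eventually_ge_atTop 3] with L hGL hL3
  have hb := abs_torusXYDirStiffness_le_of_twoPoint_bound_torusDist (L := L + 1) (by omega) hK i (hB L) hGL
  refine hb.trans (le_of_eq ?_)
  push_cast
  ring

end TwoPoint


/-! ## §5 The layered rotator on `(ℤ/Lℤ)³`: no stack stiffness in the limit wherever ONE cube number is `< 1` -/

namespace AnisotropicRotator

/- The floor files fix the Borel structure of `Circle` as a global instance (`corr`, `plateau`); the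
instance-generic theorems of §1–§4 are used at that instance below (no local instances in this section). -/

variable [NeZero L]

/-- **In-plane and interlayer stack stiffness are f-sum bounded by their own bond energies**: for the layered
couplings `K = (βJ∥, βJ∥, βJ⊥)`, `βΥ_{L,i} ≤ K_i · ⟨cos(θ_{eᵢ} − θ_0)⟩_K = K_i · corr K 0 eᵢ` (in-plane `i = 0, 1`:
`≤ βJ∥·E∥`; interlayer `i = 2`: `≤ βJ⊥·E⊥ ≤ βJ⊥` — the c-axis stiffness of the stack is at most the interlayer
coupling). [cite: FisherBarberJasnow1973, §II eqs. (2.4)–(2.5) (helicity modulus); LiuStanley1972 p. 272 (layers (J, J, εJ))] -/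
theorem torusXYDirStiffness_layered_le_corr (Kp Kz : ℝ) (i : Fin 3) :
    torusXYDirStiffness L (layeredCoupling Kp Kz) i ≤
      layeredCoupling Kp Kz i * corr (layeredCoupling Kp Kz) (0 : TorusSite 3 L) (Pi.single i 1) := by
  have h := torusXYDirStiffness_le_energy (L := L) (layeredCoupling Kp Kz) i 0
  rwa [zero_add, ← corr_eq_expectJ] at h

/-- **The layered stack stiffness under the cube criterion.** For `β, J∥, J⊥ ≥ 0`, `R ≥ 1`, `L ≥ 4`, `L ≥ 2R + 2` and
`S_{(R,R,R)}(β; J∥, J⊥) ≤ 1` (Lieb's number of the free reference CUBE of the layered couplings, tree `aboxShellSum`):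
for every twist direction `i`,

  `|βΥ_{L,i}(βJ∥, βJ∥, βJ⊥)| ≤ 4·K_i²·L³·S^{2⌊(⌊L/2⌋−1)/R⌋}`

— the torus cube criterion `corr ≤ S^{aIndex}` (`corr_layered_le_pow_cube`) at every pair of sites at `i`-coordinate
distance `≥ ⌊L/2⌋ − 1`, squared by §4. [cite: Lieb1980, Theorem 4 and p. 128 (boxes: the decay input); BricmontFontaineLandau1977 Appendix Thm A2 (decoupling); FisherBarberJasnow1973 §II (Υ)] -/
theorem abs_torusXYDirStiffness_layered_le_cube {β Jp Jz : ℝ} (hβ : 0 ≤ β) (hp : 0 ≤ Jp) (hz : 0 ≤ Jz) {R : ℕ}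
    (hR : 1 ≤ R) (hL : 4 ≤ L) (hLR : 2 * R + 2 ≤ L)
    (hS1 : aboxShellSum (fun u v : Site 3 => β / 2 * LongRangeIsing.layeredCoupling Jp Jz u v) (fun _ : Fin 3 => R) ≤ 1)
    (i : Fin 3) :
    |torusXYDirStiffness L (layeredCoupling (β * Jp) (β * Jz)) i| ≤
      4 * layeredCoupling (β * Jp) (β * Jz) i ^ 2 * (L : ℝ) ^ 3 *
        (aboxShellSum (fun u v : Site 3 => β / 2 * LongRangeIsing.layeredCoupling Jp Jz u v) (fun _ : Fin 3 => R) ^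
          ((L / 2 - 1) / R)) ^ 2 := by
  set S : ℝ := aboxShellSum (fun u v : Site 3 => β / 2 * LongRangeIsing.layeredCoupling Jp Jz u v)
    (fun _ : Fin 3 => R) with hS
  have hS0 : 0 ≤ S :=
    aboxShellSum_nonneg (fun u v => mul_nonneg (by positivity) (LongRangeIsing.layeredCoupling_nonneg hp hz u v)) _
  have hK : ∀ m, 0 ≤ layeredCoupling (β * Jp) (β * Jz) m := fun m =>
    layeredCoupling_nonneg (mul_nonneg hβ hp) (mul_nonneg hβ hz) m
  refine abs_torusXYDirStiffness_le_of_twoPoint_bound hL hK i (pow_nonneg hS0 _) fun a c hac => ?_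
  rw [← corr_eq_expectJ]
  refine (corr_layered_le_pow_cube hβ hp hz hR hLR a c).trans ?_
  refine pow_le_pow_of_le_one hS0 hS1 ?_
  refine le_trans ?_ (div_le_aIndex (fun _ : Fin 3 => R) (fun k => ((a - c) k).valMinAbs) i)
  exact Nat.div_le_div_right hac

/-- **Polynomial × geometric**: `(n + 1)^k r^n → 0` for `|r| < 1`. [folklore] -/
private theorem tendsto_succ_pow_mul_pow {r : ℝ} (hr : |r| < 1) (k : ℕ) :
    Tendsto (fun n : ℕ => ((n : ℝ) + 1) ^ k * r ^ n) atTop (𝓝 0) := by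
  have hr0 : 0 ≤ |r| := abs_nonneg r
  have h := (tendsto_pow_const_mul_const_pow_of_abs_lt_one k (r := |r|) (by rwa [abs_abs])).const_mul
    ((2 : ℝ) ^ k)
  rw [mul_zero] at h
  have hbound : ∀ᶠ n : ℕ in atTop, |((n : ℝ) + 1) ^ k * r ^ n| ≤ (2 : ℝ) ^ k * ((n : ℝ) ^ k * |r| ^ n) := by
    filter_upwards [eventually_ge_atTop 1] with n hn
    have hn' : (1 : ℝ) ≤ n := by exact_mod_cast hn
    rw [abs_mul, abs_pow, abs_pow, abs_of_nonneg (by positivity : (0 : ℝ) ≤ (n : ℝ) + 1), ← mul_assoc,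
      ← mul_pow]
    refine mul_le_mul_of_nonneg_right (pow_le_pow_left₀ (by positivity) (by linarith) k) (by positivity)
  exact squeeze_zero_norm' hbound h

/-- **The Lieb–Simon finite algorithm kills the stack stiffness.** For `β, J∥, J⊥ ≥ 0`: if `S_{(R,R,R)}(β; J∥, J⊥) < 1`
for ONE radius `R ≥ 1`, then for every twist direction `i` (in-plane and interlayer)

  `βΥ_{L,i}(βJ∥, βJ∥, βJ⊥) → 0`  as `L → ∞`

— the majorant `4K_i²L³·S^{2⌊(⌊L/2⌋−1)/R⌋}` is a cubic times a geometric sequence in `n = ⌊(⌊L/2⌋−1)/R⌋`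
(`L ≤ 2R(n+1) + 2`). The three-dimensional, anisotropic twin of `tendsto_torusXYStiffness_of_nnBoxShellSum_lt_one`.
[cite: Lieb1980, Theorem 4 and p. 128 (φ(β) < 1 for some box ⇒ exponential decay: a finite algorithm); Simon1980CMP Thm 1.3; FisherBarberJasnow1973 §II] -/
theorem tendsto_torusXYDirStiffness_layered_of_cube_lt_one {β Jp Jz : ℝ} (hβ : 0 ≤ β) (hp : 0 ≤ Jp)
    (hz : 0 ≤ Jz) {R : ℕ} (hR : 1 ≤ R)
    (hS : aboxShellSum (fun u v : Site 3 => β / 2 * LongRangeIsing.layeredCoupling Jp Jz u v) (fun _ : Fin 3 => R) < 1)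
    (i : Fin 3) :
    Tendsto (fun L : ℕ => torusXYDirStiffness (L + 1) (layeredCoupling (β * Jp) (β * Jz)) i) atTop (𝓝 0) := by
  set S : ℝ := aboxShellSum (fun u v : Site 3 => β / 2 * LongRangeIsing.layeredCoupling Jp Jz u v)
    (fun _ : Fin 3 => R) with hSdef
  have hS0 : 0 ≤ S :=
    aboxShellSum_nonneg (fun u v => mul_nonneg (by positivity) (LongRangeIsing.layeredCoupling_nonneg hp hz u v)) _
  have hK : ∀ m, 0 ≤ layeredCoupling (β * Jp) (β * Jz) m := fun m =>
    layeredCoupling_nonneg (mul_nonneg hβ hp) (mul_nonneg hβ hz) m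
  set Ki : ℝ := layeredCoupling (β * Jp) (β * Jz) i with hKi
  set r : ℝ := S ^ 2 with hr
  have hr0 : 0 ≤ r := by positivity
  have hr1 : |r| < 1 := by
    rw [abs_of_nonneg hr0, hr]
    nlinarith
  have hR0 : (0 : ℝ) < R := by exact_mod_cast hR
  -- the majorant along `n ↦ 4Kᵢ²(2R+2)³ (n+1)³ rⁿ`
  have hg : Tendsto (fun n : ℕ => 4 * Ki ^ 2 * (2 * (R : ℝ) + 2) ^ 3 * (((n : ℝ) + 1) ^ 3 * r ^ n)) atTop (𝓝 0) := by
    have := (tendsto_succ_pow_mul_pow hr1 3).const_mul (4 * Ki ^ 2 * (2 * (R : ℝ) + 2) ^ 3)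
    rwa [mul_zero] at this
  -- compose with `L ↦ ⌊((L+1)/2 − 1)/R⌋ → ∞`
  have hidx : Tendsto (fun L : ℕ => ((L + 1) / 2 - 1) / R) atTop atTop := by
    refine tendsto_atTop_atTop.2 fun b => ⟨2 * (b * R) + 2, fun L hL => ?_⟩
    refine (Nat.le_div_iff_mul_le hR).2 ?_
    omega
  refine tendsto_torusXYDirStiffness_of_abs_le hK i (hg.comp hidx) ?_
  filter_upwards [eventually_ge_atTop (2 * R + 2)] with L hL
  have hb := abs_torusXYDirStiffness_layered_le_cube (L := L + 1) hβ hp hz hR (by omega) (by omega) hS.le i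
  refine hb.trans ?_
  simp only [Function.comp]
  set n : ℕ := ((L + 1) / 2 - 1) / R with hn
  -- `L + 1 ≤ 2R(n + 1) + 2 ≤ (2R + 2)(n + 1)`
  have hLn : ((L + 1 : ℕ) : ℝ) ≤ (2 * R + 2) * ((n : ℝ) + 1) := by
    have h1 : (L + 1) / 2 - 1 < R * (n + 1) := by
      rw [hn]; exact Nat.lt_mul_div_succ _ hR
    have h2 : (L + 1 : ℕ) ≤ 2 * (R * n) + 2 * R + 2 * n + 2 := by
      have : (L + 1) / 2 ≤ R * n + R := by
        have := h1; rw [Nat.mul_succ] at this; omega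
      omega
    have h3 : ((L + 1 : ℕ) : ℝ) ≤ ((2 * (R * n) + 2 * R + 2 * n + 2 : ℕ) : ℝ) := by exact_mod_cast h2
    push_cast at h3 ⊢
    linarith [h3, show ((2 : ℝ) * R + 2) * ((n : ℝ) + 1) = 2 * ((R : ℝ) * n) + 2 * R + 2 * n + 2 by ring]
  have hpow : (S ^ n) ^ 2 = r ^ n := by rw [hr, ← pow_mul, ← pow_mul, mul_comm]
  rw [← hSdef, ← hKi, hpow]
  have hL0 : (0 : ℝ) ≤ ((L + 1 : ℕ) : ℝ) := Nat.cast_nonneg _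
  have hrn : 0 ≤ r ^ n := pow_nonneg hr0 _
  have hcube : ((L + 1 : ℕ) : ℝ) ^ 3 ≤ ((2 * R + 2) * ((n : ℝ) + 1)) ^ 3 := pow_le_pow_left₀ hL0 hLn 3
  push_cast at hcube ⊢
  have hKi0 : 0 ≤ Ki ^ 2 := sq_nonneg _
  calc 4 * Ki ^ 2 * ((L : ℝ) + 1) ^ 3 * r ^ n
      ≤ 4 * Ki ^ 2 * ((2 * R + 2) * ((n : ℝ) + 1)) ^ 3 * r ^ n := by
        exact mul_le_mul_of_nonneg_right (mul_le_mul_of_nonneg_left hcube (by positivity)) hrn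
    _ = 4 * Ki ^ 2 * (2 * (R : ℝ) + 2) ^ 3 * (((n : ℝ) + 1) ^ 3 * r ^ n) := by ring

/-- For every `ε > 0`, eventually in `L`: `0 ≤ βΥ_{L,i} < ε` in every direction, under the cube criterion.
[cite: Lieb1980, Theorem 4 and p. 128 (boxes)] -/
theorem eventually_torusXYDirStiffness_layered_lt_of_cube_lt_one {β Jp Jz : ℝ} (hβ : 0 ≤ β) (hp : 0 ≤ Jp)
    (hz : 0 ≤ Jz) {R : ℕ} (hR : 1 ≤ R)
    (hS : aboxShellSum (fun u v : Site 3 => β / 2 * LongRangeIsing.layeredCoupling Jp Jz u v) (fun _ : Fin 3 => R) < 1)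
    (i : Fin 3) {ε : ℝ} (hε : 0 < ε) :
    ∀ᶠ L : ℕ in atTop, 0 ≤ torusXYDirStiffness (L + 1) (layeredCoupling (β * Jp) (β * Jz)) i ∧
      torusXYDirStiffness (L + 1) (layeredCoupling (β * Jp) (β * Jz)) i < ε := by
  have hK : ∀ m, 0 ≤ layeredCoupling (β * Jp) (β * Jz) m := fun m =>
    layeredCoupling_nonneg (mul_nonneg hβ hp) (mul_nonneg hβ hz) m
  filter_upwards [(tendsto_order.1 (tendsto_torusXYDirStiffness_layered_of_cube_lt_one hβ hp hz hR hS i)).2 ε hε]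
    with L hL
  exact ⟨torusXYDirStiffness_nonneg hK i, hL⟩

/-! ### `T_Υ^{3D}(J∥, J⊥) ≤ T_χ^{3D}(J∥, J⊥)`: the structural half -/

/-- **A finite free susceptibility kills the stack stiffness**: if `∑_{z ∈ ℤ³} G^{3D,free,∞}_{β;J∥,J⊥}(0, z) < ∞`
(tree `infTwoPointLayered`), then `βΥ_{L,i}(βJ∥, βJ∥, βJ⊥) → 0` for every twist direction `i` — Simon–Lieb: a
summable two-point function makes some cube terminate (`exists_cube_lt_one_of_summable_layered`).
[cite: Simon1980CMP, Thm 1.3; Lieb1980, Theorem 4 and p. 128 (finite algorithm); FisherBarberJasnow1973 §II] -/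
theorem tendsto_torusXYDirStiffness_layered_of_summable {β Jp Jz : ℝ} (hβ : 0 ≤ β) (hp : 0 ≤ Jp) (hz : 0 ≤ Jz)
    (hG : Summable fun z : Site 3 => infTwoPointLayered β Jp Jz 0 z) (i : Fin 3) :
    Tendsto (fun L : ℕ => torusXYDirStiffness (L + 1) (layeredCoupling (β * Jp) (β * Jz)) i) atTop (𝓝 0) := by
  obtain ⟨R, hR, hS⟩ := exists_cube_lt_one_of_summable_layered hβ hp hz hG
  exact tendsto_torusXYDirStiffness_layered_of_cube_lt_one hβ hp hz hR hS i

/-- **`T_Υ^{3D} ≤ T_χ^{3D}` (structural half, periodic objects).** If the periodic susceptibility of the layered rotator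
`χ^{3D,per}_L(0) = ∑_y corr (βJ∥, βJ∥, βJ⊥) 0 y` is eventually bounded in `L`, then the stack carries no stiffness in
the thermodynamic limit: `βΥ_{L,i} → 0` for every twist direction (tree
`torus_susceptibility_bounded_iff_summable_layered`). The susceptibility-divergence threshold bounds the stiffness
onset of the stack from above, at every anisotropy. [cite: Simon1980CMP, Thm 1.3; Lieb1980, Theorem 4 and p. 128; FisherBarberJasnow1973 §II] -/
theorem tendsto_torusXYDirStiffness_layered_of_torus_susceptibility_bounded {β Jp Jz : ℝ} (hβ : 0 ≤ β)
    (hp : 0 ≤ Jp) (hz : 0 ≤ Jz)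
    (hχ : ∃ (B : ℝ) (L₀ : ℕ), ∀ (L : ℕ) [NeZero L], L₀ ≤ L →
      ∑ y : TorusSite 3 L, corr (layeredCoupling (β * Jp) (β * Jz)) 0 y ≤ B) (i : Fin 3) :
    Tendsto (fun L : ℕ => torusXYDirStiffness (L + 1) (layeredCoupling (β * Jp) (β * Jz)) i) atTop (𝓝 0) :=
  tendsto_torusXYDirStiffness_layered_of_summable hβ hp hz
    ((torus_susceptibility_bounded_iff_summable_layered hβ hp hz).1 hχ) i

/-- **Contrapositive: a surviving stack stiffness forces an infinite susceptibility.** If for some twist direction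
`βΥ_{L+1,i}(βJ∥, βJ∥, βJ⊥) ↛ 0`, then `∑_z G^{3D,free,∞}(0, z) = ∞` (not summable).
[cite: Simon1980CMP, Thm 1.3; Lieb1980, Theorem 4 and p. 128; FisherBarberJasnow1973 §II] -/
theorem not_summable_layered_of_not_tendsto_torusXYDirStiffness {β Jp Jz : ℝ} (hβ : 0 ≤ β) (hp : 0 ≤ Jp)
    (hz : 0 ≤ Jz) {i : Fin 3}
    (hnot : ¬ Tendsto (fun L : ℕ => torusXYDirStiffness (L + 1) (layeredCoupling (β * Jp) (β * Jz)) i)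
      atTop (𝓝 0)) :
    ¬ Summable fun z : Site 3 => infTwoPointLayered β Jp Jz 0 z :=
  fun hG => hnot (tendsto_torusXYDirStiffness_layered_of_summable hβ hp hz hG i)

/-- … and makes the periodic susceptibility unbounded: `∀ B L₀ ∃ L ≥ L₀, χ^{3D,per}_L(0) > B`.
[cite: Simon1980CMP, Thm 1.3; Lieb1980, Theorem 4 and p. 128; FisherBarberJasnow1973 §II] -/
theorem torus_susceptibility_unbounded_of_not_tendsto_torusXYDirStiffness {β Jp Jz : ℝ} (hβ : 0 ≤ β)
    (hp : 0 ≤ Jp) (hz : 0 ≤ Jz) {i : Fin 3}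
    (hnot : ¬ Tendsto (fun L : ℕ => torusXYDirStiffness (L + 1) (layeredCoupling (β * Jp) (β * Jz)) i)
      atTop (𝓝 0)) (B : ℝ) (L₀ : ℕ) :
    ∃ (L : ℕ) (_ : NeZero L), L₀ ≤ L ∧ B < ∑ y : TorusSite 3 L, corr (layeredCoupling (β * Jp) (β * Jz)) 0 y := by
  by_contra hcon
  push Not at hcon
  exact hnot (tendsto_torusXYDirStiffness_layered_of_torus_susceptibility_bounded hβ hp hz
    ⟨B, L₀, fun L _ hL => hcon L inferInstance hL⟩ i)

/-- … and no cube terminates: `S_{(R,R,R)}(β; J∥, J⊥) ≥ 1` for every `R ≥ 1`.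
[cite: Lieb1980, Theorem 4 and p. 128 (finite algorithm); Simon1980CMP Thm 1.3] -/
theorem one_le_cube_of_not_tendsto_torusXYDirStiffness {β Jp Jz : ℝ} (hβ : 0 ≤ β) (hp : 0 ≤ Jp) (hz : 0 ≤ Jz)
    {i : Fin 3}
    (hnot : ¬ Tendsto (fun L : ℕ => torusXYDirStiffness (L + 1) (layeredCoupling (β * Jp) (β * Jz)) i)
      atTop (𝓝 0)) {R : ℕ} (hR : 1 ≤ R) :
    1 ≤ aboxShellSum (fun u v : Site 3 => β / 2 * LongRangeIsing.layeredCoupling Jp Jz u v) (fun _ : Fin 3 => R) := by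
  by_contra h
  exact hnot (tendsto_torusXYDirStiffness_layered_of_cube_lt_one hβ hp hz hR (not_le.1 h) i)

/-! ### Explicit finite-volume ceilings from explicit torus decay -/

/-- **Explicit ceiling at every `L ≥ 4` from a torus decay bound**: if `corr (βJ∥, βJ∥, βJ⊥) a c ≤ m^{dist_∞(a,c)}` for
all sites of `(ℤ/Lℤ)³` with `0 ≤ m ≤ 1`, then `|βΥ_{L,i}| ≤ 4K_i²·L³·m^{2(⌊L/2⌋−1)}` in every direction.
[cite: BricmontFontaineLandau1977, Appendix Thm A2; Lieb1980 Theorem 4 (decay input); FisherBarberJasnow1973 §II] -/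
theorem abs_torusXYDirStiffness_layered_le_of_corr_le_pow {β Jp Jz m : ℝ} (hβ : 0 ≤ β) (hp : 0 ≤ Jp) (hz : 0 ≤ Jz)
    (hm0 : 0 ≤ m) (hm1 : m ≤ 1) (hL : 4 ≤ L)
    (hcorr : ∀ a c : TorusSite 3 L, corr (layeredCoupling (β * Jp) (β * Jz)) a c ≤ m ^ torusDist a c) (i : Fin 3) :
    |torusXYDirStiffness L (layeredCoupling (β * Jp) (β * Jz)) i| ≤
      4 * layeredCoupling (β * Jp) (β * Jz) i ^ 2 * (L : ℝ) ^ 3 * (m ^ (L / 2 - 1)) ^ 2 := by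
  have hK : ∀ k, 0 ≤ layeredCoupling (β * Jp) (β * Jz) k := fun k =>
    layeredCoupling_nonneg (mul_nonneg hβ hp) (mul_nonneg hβ hz) k
  refine abs_torusXYDirStiffness_le_of_twoPoint_bound_torusDist hL hK i (pow_nonneg hm0 _) fun a c hac => ?_
  rw [← corr_eq_expectJ]
  exact (hcorr a c).trans (pow_le_pow_of_le_one hm0 hm1 hac)

/-- **Lieb's star on the torus, explicitly, for the stiffness**: for `β, J∥, J⊥ ≥ 0` with `βJ∥ ≤ x`, `0 < x`, `βJ⊥ ≤ y`
and `m := 4x/√(x²+4) + y ≤ 1`, every `L ≥ 4` and every direction: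
`|βΥ_{L,i}(βJ∥, βJ∥, βJ⊥)| ≤ 4K_i²·L³·m^{2(⌊L/2⌋−1)}` (tree `corr_layered_le_pow_amos_of_le`).
[cite: Lieb1980, Theorem 4 (β_c ≥ 0.52 for ν = 2); Amos1974, eq. (11) (m = 0); FisherBarberJasnow1973 §II] -/
theorem abs_torusXYDirStiffness_layered_le_amos {β Jp Jz x y : ℝ} (hβ : 0 ≤ β) (hp : 0 ≤ Jp) (hz : 0 ≤ Jz)
    (hx0 : 0 < x) (hy0 : 0 ≤ y) (hx : β * Jp ≤ x) (hy : β * Jz ≤ y)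
    (hm1 : 4 * (x / Real.sqrt (x ^ 2 + 4)) + y ≤ 1) (hL : 4 ≤ L) (i : Fin 3) :
    |torusXYDirStiffness L (layeredCoupling (β * Jp) (β * Jz)) i| ≤
      4 * layeredCoupling (β * Jp) (β * Jz) i ^ 2 * (L : ℝ) ^ 3 *
        ((4 * (x / Real.sqrt (x ^ 2 + 4)) + y) ^ (L / 2 - 1)) ^ 2 := by
  have hm0 : 0 ≤ 4 * (x / Real.sqrt (x ^ 2 + 4)) + y :=
    add_nonneg (mul_nonneg (by norm_num) (div_nonneg hx0.le (Real.sqrt_nonneg _))) hy0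
  exact abs_torusXYDirStiffness_layered_le_of_corr_le_pow hβ hp hz hm0 hm1 hL
    (fun a c => corr_layered_le_pow_amos_of_le hβ hp hz hx0 hy0 hx hy hL a c) i

/-- **The headline window `(βJ∥, βJ⊥) ≤ (1/2, 0.0298)` on the torus, explicitly**: for every `L ≥ 4` and direction,
`|βΥ_{L,i}| ≤ 4K_i²·L³·0.99997^{2(⌊L/2⌋−1)}` (tree `corr_layered_window_half`). [cite: Lieb1980, Theorem 4 (β_c ≥ 0.52 for ν = 2); Amos1974, eq. (11) (m = 0); FisherBarberJasnow1973 §II] -/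
theorem abs_torusXYDirStiffness_layered_window_half {β Jp Jz : ℝ} (hβ : 0 ≤ β) (hp : 0 ≤ Jp) (hz : 0 ≤ Jz)
    (hx : β * Jp ≤ 1 / 2) (hy : β * Jz ≤ 149 / 5000) (hL : 4 ≤ L) (i : Fin 3) :
    |torusXYDirStiffness L (layeredCoupling (β * Jp) (β * Jz)) i| ≤
      4 * layeredCoupling (β * Jp) (β * Jz) i ^ 2 * (L : ℝ) ^ 3 *
        ((99997 / 100000 : ℝ) ^ (L / 2 - 1)) ^ 2 :=
  abs_torusXYDirStiffness_layered_le_of_corr_le_pow hβ hp hz (by norm_num) (by norm_num) hL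
    (fun a c => corr_layered_window_half hβ hp hz hx hy hL a c) i

/-! ### The explicit regions of record: Lieb's star region and the weak-interlayer windows -/

/-- **No stack stiffness on Lieb's star region.** For `β, J∥, J⊥ ≥ 0` with `βJ∥ ≤ x`, `βJ⊥ ≤ y` and
`4x/√(x²+4) + 2y/√(y²+4) < 1` (the closed-form weak-coupling / high-temperature region certified by Lieb's star with
Amos' Bessel-ratio bound, tree `summable_layered_of_amos_star_lt_one`): `βΥ_{L,i}(βJ∥, βJ∥, βJ⊥) → 0` in every
direction. [cite: Lieb1980, Theorem 4 (star criterion); Amos1974 (Bessel ratio bound, via the tree); FisherBarberJasnow1973 §II] -/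
theorem tendsto_torusXYDirStiffness_layered_of_amos_star_lt_one {β Jp Jz x y : ℝ} (hβ : 0 ≤ β) (hp : 0 ≤ Jp)
    (hz : 0 ≤ Jz) (hx : β * Jp ≤ x) (hy : β * Jz ≤ y)
    (hm : 4 * (x / Real.sqrt (x ^ 2 + 4)) + 2 * (y / Real.sqrt (y ^ 2 + 4)) < 1) (i : Fin 3) :
    Tendsto (fun L : ℕ => torusXYDirStiffness (L + 1) (layeredCoupling (β * Jp) (β * Jz)) i) atTop (𝓝 0) :=
  tendsto_torusXYDirStiffness_layered_of_summable hβ hp hz (summable_layered_of_amos_star_lt_one hβ hp hz hx hy hm) i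

/-- **Temperature form.** For `J∥, J⊥ ≥ 0`, `T > 0` with `4J∥/√(J∥² + 4T²) + 2J⊥/√(J⊥² + 4T²) < 1` the stack stiffness
at `β = 1/T` vanishes in the thermodynamic limit, in every direction: the layered comparison model carries no
helicity modulus on Lieb's star region (whose closure at `J⊥ = 0` is `T = (√15/2)·J∥`).
[cite: Lieb1980, Theorem 4 (star criterion); FisherBarberJasnow1973 §II] -/
theorem tendsto_torusXYDirStiffness_layered_of_amos_star_temperature {Jp Jz T : ℝ} (hp : 0 ≤ Jp) (hz : 0 ≤ Jz)
    (hT : 0 < T) (hm : 4 * (Jp / Real.sqrt (Jp ^ 2 + 4 * T ^ 2)) + 2 * (Jz / Real.sqrt (Jz ^ 2 + 4 * T ^ 2)) < 1)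
    (i : Fin 3) :
    Tendsto (fun L : ℕ => torusXYDirStiffness (L + 1) (layeredCoupling (T⁻¹ * Jp) (T⁻¹ * Jz)) i) atTop (𝓝 0) :=
  tendsto_torusXYDirStiffness_layered_of_summable (inv_nonneg.2 hT.le) hp hz
    (summable_layered_of_amos_star_temperature hp hz hT hm) i

/-- **The weak-interlayer window at every in-plane coupling with a finite layer susceptibility.** If the single layer
at coupling `K₀ ≥ 0` has `∑_x G^{2D,free,∞}_{K₀}(0, x) < ∞`, then there is `δ > 0` such that every stack with
`βJ∥ ≤ K₀` and `βJ⊥ ≤ δ` carries no stiffness in the limit, in every direction (tree `summable_layered_of_summable_layer`):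
the stiffness onset of the stack is bounded by the layer's susceptibility transition in the weak-interlayer limit,
`limsup_{J⊥ → 0} T_Υ^{3D}(J∥, J⊥) ≤ T_χ^{2D}(J∥)`. [cite: LiuStanley1972, p. 272 (layers (J, J, εJ): weak interlayer coupling); Simon1980CMP Thm 1.3; Lieb1980 Theorem 4 and p. 128] -/
theorem exists_interlayer_window_tendsto_torusXYDirStiffness_of_summable_layer {K₀ : ℝ} (hK0 : 0 ≤ K₀)
    (hG : Summable fun x : Site 2 => infTwoPoint K₀ 2 0 x) :
    ∃ δ : ℝ, 0 < δ ∧ ∀ ⦃β Jp Jz : ℝ⦄, 0 ≤ β → 0 ≤ Jp → 0 ≤ Jz → β * Jp ≤ K₀ → β * Jz ≤ δ → ∀ i : Fin 3,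
      Tendsto (fun L : ℕ => torusXYDirStiffness (L + 1) (layeredCoupling (β * Jp) (β * Jz)) i) atTop (𝓝 0) := by
  obtain ⟨δ, hδ, h⟩ := summable_layered_of_summable_layer hK0 hG
  exact ⟨δ, hδ, fun β Jp Jz hβ hp hz hx hy i =>
    tendsto_torusXYDirStiffness_layered_of_summable hβ hp hz (h hβ hp hz hx hy) i⟩

/-- **The Onsager–Aizenman–Simon window**: for every `K₀ < log(1 + √2)` (`= 2β_c` of the planar Ising model, the
Aizenman–Simon comparison) there is `δ > 0` with: `βJ∥ ≤ K₀`, `βJ⊥ ≤ δ` ⇒ no stack stiffness in the limit, every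
direction (tree `summable_layered_of_lt_log_one_add_sqrt_two`). [cite: AizenmanSimon1980RotorIsing, eqs. (1)–(2) (the layer input, via the tree); LiuStanley1972 p. 272] -/
theorem exists_interlayer_window_tendsto_torusXYDirStiffness_of_lt_log_one_add_sqrt_two {K₀ : ℝ} (hK0 : 0 ≤ K₀)
    (hK : K₀ < Real.log (1 + Real.sqrt 2)) :
    ∃ δ : ℝ, 0 < δ ∧ ∀ ⦃β Jp Jz : ℝ⦄, 0 ≤ β → 0 ≤ Jp → 0 ≤ Jz → β * Jp ≤ K₀ → β * Jz ≤ δ → ∀ i : Fin 3,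
      Tendsto (fun L : ℕ => torusXYDirStiffness (L + 1) (layeredCoupling (β * Jp) (β * Jz)) i) atTop (𝓝 0) := by
  obtain ⟨δ, hδ, h⟩ := summable_layered_of_lt_log_one_add_sqrt_two hK0 hK
  exact ⟨δ, hδ, fun β Jp Jz hβ hp hz hx hy i =>
    tendsto_torusXYDirStiffness_layered_of_summable hβ hp hz (h hβ hp hz hx hy) i⟩


/-- **The explicit weak-interlayer window from ONE two-dimensional box** (the hypothesis of the explicit-window file
`LayeredPlaneRotatorExplicitWindow.lean`): if the single-layer box number `S_R(K₀) < 1` (`R ≥ 1`, `K₀ ≥ 0`), then for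
`βJ∥ ≤ K₀` and `βJ⊥ ≤ (1 − S_R(K₀))/(2(χ^{int}_R(K₀) + 1))` the stack carries no stiffness in the limit, in every
direction (tree `summable_layered_of_nnBoxShellSum_lt_one`). [cite: Lieb1980, Theorem 4 and p. 128 (boxes; finite algorithm); LiuStanley1972 p. 272 (layers (J, J, εJ))] -/
theorem tendsto_torusXYDirStiffness_layered_of_nnBoxShellSum_lt_one {K₀ : ℝ} (hK0 : 0 ≤ K₀) {R : ℕ} (hR : 1 ≤ R)
    (hS : nnBoxShellSum K₀ 2 R < 1) {β Jp Jz : ℝ} (hβ : 0 ≤ β) (hp : 0 ≤ Jp) (hz : 0 ≤ Jz) (hx : β * Jp ≤ K₀)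
    (hy : β * Jz ≤ (1 - nnBoxShellSum K₀ 2 R) / (2 * (boxInteriorSum K₀ R + 1))) (i : Fin 3) :
    Tendsto (fun L : ℕ => torusXYDirStiffness (L + 1) (layeredCoupling (β * Jp) (β * Jz)) i) atTop (𝓝 0) :=
  tendsto_torusXYDirStiffness_layered_of_summable hβ hp hz
    (summable_layered_of_nnBoxShellSum_lt_one hK0 hR hS hβ hp hz hx hy) i

end AnisotropicRotator

end Literature.Probability.LatticeModels
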